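import Literature.AlgebraicGeometry.HodgeTheory.FermatHodgeClassesLiftToCurveAndJacobianPowersProofs
import Literature.AlgebraicGeometry.HodgeTheory.HodgeTypeProjectors
import Literature.AlgebraicGeometry.HodgeTheory.HodgeTypeExteriorProduct
import Literature.AlgebraicGeometry.HodgeTheory.ComplexBettiKunneth
import Literature.AlgebraicGeometry.HodgeTheory.WeilClassesCyclicPrymDimension
import Literature.AlgebraicGeometry.HodgeTheory.GysinFormalismHodgeOfGysin
import Literature.AlgebraicGeometry.HodgeTheory.HodgeClassOfMorphismProofs
import Literature.AlgebraicGeometry.HodgeTheory.HodgeTypeConjugation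
import Literature.AlgebraicGeometry.Motives.JacobianDimensionBounds
import Literature.AlgebraicGeometry.Motives.JacobianDimensionBettiProofs
import Literature.NumberTheory.Transcendental.DeRhamTheoremMultiplicative
import Mathlib.LinearAlgebra.Contraction
import HarnessLib

/-!
# Hodge classes on the powers of a curve lift to the powers of its Jacobian WITHOUT a polarization:
# an explicit rational, type-preserving section of `(αᴺ⁺¹)^*`

Topic `Literature/AlgebraicGeometry/HodgeTheory`. Third proofs file of the named fact
`CurvePowerHodgeClassesLiftToJacobianPowers` (`FermatHodgeClassesLiftToCurveAndJacobianPowers.lean`: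
for a smooth projective curve `C/ℂ`, a Jacobian `𝒥` of `C` and all `N, p`, the rational classes of
Hodge type `(p, p)` on `Cᴺ⁺¹` come, modulo algebraic classes, from rational `(p, p)`-classes on
`Jᴺ⁺¹` along a linear `G` carrying algebraic classes to algebraic classes), after
`FermatHodgeClassesLiftToCurveAndJacobianPowersProofs` (the fact from the `H¹` fact
`Motives.isIso_bettiCohomology_map_abelJacobi`, the polarizability fact
`smoothProjective_hodgeStructure_isPolarizable` and the contravariance of algebraic classes) and
`AbelianVarietyPullbackAlgebraicClasses` (the contravariance, proved). This file REMOVES the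
polarizability input: **the fact follows from the `H¹` fact alone**
(`CurvePowerHodgeClassesLiftToJacobianPowers_of_isIso`), equivalently from the leaf fact
`Motives.two_mul_dim_eq_finrank_bettiCohomology` of its decomposition
(`CurvePowerHodgeClassesLiftToJacobianPowers_of_two_mul_dim_eq`; the two are equivalent theorems
of the tree, `Motives.two_mul_dim_eq_finrank_bettiCohomology_iff_isIso`, their common residual
content being `b₁(C(ℂ)) ≤ 2 dim J`, whence also
`CurvePowerHodgeClassesLiftToJacobianPowers_of_finrank_le`).

The polarization entered only through C. Voisin, *Hodge and generalized Hodge conjectures, coniveau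
and algebraic cycles*, J. Open Math. Probl. 1 (2025), Cor. 2.12 (p. 24, read): "Let `H, H′` be
Hodge structures of weight `2k`, with `H′` polarized, and let `φ : H′ → H` be a surjective morphism
of Hodge structures. Then `φ : Hdg(H′) → Hdg(H)` is surjective. Indeed, this follows from the fact
that, thanks to Proposition 2.11, `φ` has a left inverse as morphism of Hodge structures." For
`φ = (αᴺ⁺¹)^* : H*(Jᴺ⁺¹, ℚ) → H*(Cᴺ⁺¹, ℚ)`, `α = f^P : C → J` the Abel–Jacobi map of a point, such a
left inverse can be WRITTEN DOWN, and this file does so on the tree's real carriers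
(`complexBetti`, `IsRationalClass`, `IsOfHodgeType`): a family of `ℂ`-linear maps
`S_k : Hᵏ(Cᴺ⁺¹(ℂ); ℂ) → Hᵏ(Jᴺ⁺¹(ℂ); ℂ)` with `(αᴺ⁺¹)^* ∘ S_k = 𝟙`, carrying rational classes to
rational classes and classes of Hodge type `(p, q)` to classes of Hodge type `(p, q)`
(`exists_section_pow`); a rational `(p, p)`-class `a` on `Cᴺ⁺¹` is then `(αᴺ⁺¹)^* b` for the
rational `(p, p)`-class `b = S(a)`.

Construction (H. Lange, Ch. Birkenhake, *Complex Abelian Varieties* (1992), §4.2.1 and Lemma 4.4.1: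
`α_{c*} : H₁(C, ℤ) → H₁(J, ℤ)` is an isomorphism, `H*(J)` is the exterior algebra on `H¹`, and in a
symplectic basis the class of the curve / of the theta divisor is `∓Σ_ν λ_ν ⋆ λ_{g+ν}`):

* On `C` itself, degree by degree (`exists_section_abelJacobi`): `s₀(ε · 1_C) = ε · 1_J`
  (`exists_section_degree_zero`); `s₁ = (α^*)⁻¹` on `H¹` (`exists_section_degree_one`, the `H¹`
  fact through `bijective_complexBetti_map_abelJacobi`; it preserves the types `(1,0)`, `(0,1)`
  because an injective pull-back detects types, `IsOfHodgeType.of_map_of_injective`);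
  `s₂(c · w₀) = c · θ₀` (`exists_section_degree_two`) with **the theta class**
  `θ₀ = (2g)⁻¹ Σᵢ s₁(dᵢ) ∪ s₁(eᵢ)` for a basis `(eᵢ)` of `H¹(C(ℂ); ℚ)` and its dual family `(dᵢ)`
  under the PERFECT `ℚ`-valued cup pairing `⟨a ∪ b, [C(ℂ)]⟩` (Hatcher Prop. 3.38, the tree's
  `isPerfPair_cupPairing_of_field_holds`) — rational by construction, `α^* θ₀ = w₀ ≠ 0`, and of
  type `(1, 1)` because the Casimir element `Σᵢ dᵢ ⊗ eᵢ` is basis independent (`sum_casimir_eq`)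
  and, in a basis adapted to `H¹ = H^{1,0} ⊕ H^{0,1}`, the dual of a `(1,0)`-class is a
  `(0,1)`-class (a curve has no `(2,0)`-classes, `H^{1,0} ∪ H^{1,0} = 0`) — `exists_thetaClass`,
  **no Hodge–Riemann positivity is used**; `s_k = 0` for `k ≥ 3` (`Hᵏ(C) = 0`).
* The Künneth step (`exists_kunnethSection`, `kunnethSection_map`, `kunnethSection_cup`,
  `kunnethSection_isRationalClass`, `kunnethSection_isOfHodgeType`): sections `s` of `f^*` and `s'`
  of `f'^*` tensor to the section `S(pr₁^* y ∪ pr₂^* y') = pr₁^* s(y) ∪ pr₂^* s'(y')` of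
  `(f × f')^*`, well defined by the uniqueness of the Künneth expansion
  (`complexBetti_kunneth_bijective`, Hatcher Thm. 3.16); rationality through rational Künneth bases
  (`exists_basis_isRationalClass`) and the lemma that the coefficients of a rational class along a
  `ℂ`-independent family of rational classes are rational
  (`IsRationalClass.coeff_mem_range_of_linearIndependent`, from the injectivity of
  `ℂ ⊗_ℚ Hᵏ(–; ℚ) → Hᵏ(–; ℂ)`); Hodge types through the expansion of a class into exterior products
  of pure-type components and the additivity of types under exterior products (Voisin I,
  Thm. 11.38 — the tree's `isOfHodgeType_cupProduct_map_map_of_cupPreservesHodgeType` with de Rham's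
  theorem in multiplicative form `exists_deRhamIsoFamily_holds`), `HodgeModel.mem_typePiece_map_of_sum_eq`.
* Induction over `N` along `Cᴺ⁺² = Cᴺ⁺¹ ⊗ C`, `Jᴺ⁺² = Jᴺ⁺¹ ⊗ J`, `αᴺ⁺² = αᴺ⁺¹ × α`
  (`exists_section_pow`), and the assembly with the genus-`0` case and the contravariance of
  algebraic classes of the sibling files.

Everything is proved; no definition and no named fact is introduced (D-0026). What remains of
`CurvePowerHodgeClassesLiftToJacobianPowers_holds` is exactly ONE named fact,
`Motives.two_mul_dim_eq_finrank_bettiCohomology` (`2 dim J = b₁(C(ℂ))`, Milne Prop. 2.1; ⟺ the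
`H¹` fact), i.e. the inequality `b₁(C(ℂ)) ≤ 2 dim J` (the transcendental existence of the Jacobian).

## References

* [Voisin2025] C. Voisin, Hodge and generalized Hodge conjectures, coniveau and algebraic cycles,
  J. Open Math. Probl. 1 (2025), Prop. 2.11 and Cor. 2.12 (p. 24).
* [LangeBirkenhake1992] H. Lange, Ch. Birkenhake, Complex Abelian Varieties, Grundlehren 302
  (1992), §4.2.1 (proof of Poincaré's Formula: `{W̃₁} = -Σ λ_ν ⋆ λ_{g+ν}`), Lemma 4.4.1 (proof:
  `α_c^*` on `H¹` is the transpose of the isomorphism `α_{c*}`).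
* [Lange2023AbelianVarietiesC] H. Lange, Abelian Varieties over the Complex Numbers (2023), §4.1.1
  and Lemma 4.4.1.
* [Milne1986JacobianVarieties] J. S. Milne, Jacobian Varieties (1986), Prop. 2.1, Thm. 2.5.
* [VoisinHodgeI2002] C. Voisin, Hodge Theory and Complex Algebraic Geometry I (2002), Thm. 6.18,
  §7.1.1, §7.3.2, Thm. 11.38.
* [HatcherAT2002] A. Hatcher, Algebraic Topology (2002), §3.1 p. 198–199, §3.2 Thm. 3.16,
  §3.3 Prop. 3.38.
* [Fulton1998] W. Fulton, Intersection Theory (1998), §19.2 Cor. 19.2, Example 19.1.11.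
-/

noncomputable section

open CategoryTheory AlgebraicGeometry MonoidalCategory CartesianMonoidalCategory
open Literature.AlgebraicTopology.SingularHomology
open Literature.AlgebraicGeometry.Motives

namespace Literature.AlgebraicGeometry.HodgeTheory

/-! ### 1. Rational classes: coefficients along an independent rational family; rational bases -/

section Rational

/-- **Coefficients of a rational class along a `ℂ`-independent family of rational classes are
rational.** If `v₁, …, v_r ∈ Hᵏ(Y; ℂ)` are rational classes, linearly independent over `ℂ`, and
`Σ cᵢ vᵢ` is a rational class, then every `cᵢ` is rational: writing `vᵢ = ι(wᵢ)`,
`Σ cᵢ vᵢ = ι(w)`, either `w` lies in the `ℚ`-span of the `wᵢ` — and then the `cᵢ` are its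
(rational) coordinates by independence — or `(w, wᵢ)` is `ℚ`-independent, hence `ℂ`-independent
after `ι` (injectivity of `ℂ ⊗_ℚ Hᵏ(Y; ℚ) → Hᵏ(Y; ℂ)`, `linearIndependent_ringChange_iff`), which
the displayed relation forbids. [cite: VoisinHodgeI2002, §7.1.1] [cite: HatcherAT2002, §3.1 Thm. 3.2 and p. 198] -/
theorem IsRationalClass.coeff_mem_range_of_linearIndependent {Y : Type} [TopologicalSpace Y] {k : ℕ}
    {ι : Type*} [Fintype ι] {v : ι → singularCohomology ℂ ℂ Y k} (hv : ∀ i, IsRationalClass (v i))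
    (hli : LinearIndependent ℂ v) {c : ι → ℂ} (hz : IsRationalClass (∑ i, c i • v i)) (i : ι) :
    c i ∈ Set.range (algebraMap ℚ ℂ) := by
  classical
  choose w hw using fun i ↦ (hv i).exists_ringChange_eq
  obtain ⟨x, hx⟩ := hz.exists_ringChange_eq
  have hvw : v = fun i ↦ singularCohomology.ringChange (algebraMap ℚ ℂ) Y k (w i) :=
    funext fun i ↦ (hw i).symm
  have hwli : LinearIndependent ℚ w := (linearIndependent_ringChange_iff w).1 (hvw ▸ hli)
  -- `x` lies in the `ℚ`-span of the `wᵢ`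
  have hxmem : x ∈ Submodule.span ℚ (Set.range w) := by
    by_contra hxn
    have hind : LinearIndependent ℚ (fun o : Option ι ↦ Option.casesOn' o x w) :=
      linearIndependent_option'.2 ⟨hwli, hxn⟩
    have hindC := (linearIndependent_ringChange_iff _).2 hind
    -- the relation `ι x - Σ cᵢ ι wᵢ = 0`
    have hrel : ∑ o : Option ι, (Option.casesOn' o (1 : ℂ) fun i ↦ -c i) •
        singularCohomology.ringChange (algebraMap ℚ ℂ) Y k (Option.casesOn' o x w) = 0 := by
      rw [Fintype.sum_option]
      simp only [Option.casesOn'_none, Option.casesOn'_some, one_smul, neg_smul,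
        Finset.sum_neg_distrib, hx, hw]
      exact add_neg_cancel _
    have h1 := Fintype.linearIndependent_iff.1 hindC _ hrel none
    rw [Option.casesOn'_none] at h1
    exact one_ne_zero h1
  obtain ⟨q, hq⟩ := (Submodule.mem_span_range_iff_exists_fun ℚ).1 hxmem
  -- compare the two expansions of `Σ cᵢ vᵢ`
  have hz' : ∑ i, (c i - ((q i : ℚ) : ℂ)) • v i = 0 := by
    simp only [sub_smul, Finset.sum_sub_distrib]
    rw [sub_eq_zero, ← hx, ← hq, ringChange_sum_smul]
    simp only [hw]
  have hci := Fintype.linearIndependent_iff.1 hli _ hz' i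
  exact ⟨q i, by rw [sub_eq_zero] at hci; rw [hci]; rfl⟩

variable {n : ℕ} {X : SchemeOver ℂ}

/-- **A `ℂ`-basis of `Hᵏ(X(ℂ); ℂ)` consisting of rational classes** (`X` smooth projective): the
image of a `ℚ`-basis of `Hᵏ(X(ℂ); ℚ)` under the complexification isomorphism
`ℂ ⊗_ℚ Hᵏ(X(ℂ); ℚ) ≅ Hᵏ(X(ℂ); ℂ)` (`ofRatClassBaseChange_injective/surjective`; Voisin I §7.1.1,
`Hᵏ(X, ℚ) ⊗ ℂ = Hᵏ(X, ℂ)`). [cite: VoisinHodgeI2002, §7.1.1] -/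
theorem exists_basis_isRationalClass (hX : IsSmoothProjective n X) (k : ℕ) :
    ∃ (r : ℕ) (b : Module.Basis (Fin r) ℂ (complexBetti X k)), ∀ i, IsRationalClass (b i) := by
  haveI := finite_singularCohomology_rat_complexPoints hX k
  set β := Module.finBasis ℚ (singularCohomology ℚ ℚ (ComplexPoints X) k) with hβ
  set B := Algebra.TensorProduct.basis ℂ β with hB
  set Θ := LinearEquiv.ofBijective (ofRatClassBaseChange (ComplexPoints X) k)
    ⟨ofRatClassBaseChange_injective (ComplexPoints X) k, ofRatClassBaseChange_surjective hX k⟩ with hΘ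
  refine ⟨_, B.map Θ, fun i ↦ ?_⟩
  rw [Module.Basis.map_apply, hB, Algebra.TensorProduct.basis_apply, hΘ, LinearEquiv.ofBijective_apply,
    ofRatClassBaseChange_tmul, one_smul]
  exact isRationalClass_ofRatClass _

end Rational

/-! ### 2. Hodge types: injective pull-backs detect types; transport along a typed expansion -/

section Types

variable {m n : ℕ} {X Y : SchemeOver ℂ}

/-- Membership in the type piece `(p, q)` of a Hodge model is the Hodge type `(p, q)` (types of a
smooth projective variety may be read in any model, `isOfHodgeType_iff_mem_hodgePQ`).
[cite: VoisinHodgeI2002, Prop. 6.11 and §7.1.1] -/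
theorem HodgeModel.mem_typePiece_iff_isOfHodgeType (hX : IsSmoothProjective n X) (A : HodgeModel n X)
    {k : ℕ} (pq : ↥(Finset.HasAntidiagonal.antidiagonal k)) (c : complexBetti X k) :
    c ∈ A.typePiece k pq ↔ IsOfHodgeType n X k pq.1.1 pq.1.2 c :=
  (A.mem_typePiece_iff pq c).trans (isOfHodgeType_iff_mem_hodgePQ hX A c).symm

/-- **Injective pull-backs detect Hodge types.** For a `ℂ`-morphism `f : Y ⟶ X` of smooth
projective varieties with `f^*` injective on `Hᵏ(–(ℂ); ℂ)`, a class `c ∈ Hᵏ(X(ℂ); ℂ)` whose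
pull-back `f^* c` is of type `(p, q)`, `p + q = k`, is itself of type `(p, q)`: `f^*` commutes with
the type projectors (it preserves every type piece and the type decompositions are direct), so the
components of `c` of type `≠ (p, q)` pull back to `0`, hence vanish.
[cite: VoisinHodgeI2002, Thm. 6.18 and §7.3.2] -/
theorem IsOfHodgeType.of_map_of_injective (hY : IsSmoothProjective m Y) (hX : IsSmoothProjective n X)
    (f : Y ⟶ X) {k p q : ℕ} (hpq : p + q = k)
    (hf : Function.Injective (complexBetti.map f k)) {c : complexBetti X k}
    (hc : IsOfHodgeType m Y k p q (complexBetti.map f k c)) : IsOfHodgeType n X k p q c := by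
  obtain ⟨A⟩ := nonempty_hodgeModel_holds (n := n) (X := X) hX
  obtain ⟨B⟩ := nonempty_hodgeModel_holds (n := m) (X := Y) hY
  let pq : ↥(Finset.HasAntidiagonal.antidiagonal k) :=
    ⟨(p, q), Finset.HasAntidiagonal.mem_antidiagonal.2 hpq⟩
  -- `f^* (π_t c)` lies in the `t`-piece of `Y`
  have hmem : ∀ t, complexBetti.map f k (A.typeProj k t c) ∈ B.typePiece k t := fun t ↦
    (B.mem_typePiece_iff_isOfHodgeType hY t _).2
      (((A.mem_typePiece_iff_isOfHodgeType hX t _).1 (A.typeProj_mem k t c)).map_of_isSmoothProjective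
        hY hX f)
  -- uniqueness of the type decomposition on `Y`: `π_t (f^* c) = f^* (π_t c)`
  have hsum : ∑ t, complexBetti.map f k (A.typeProj k t c) = complexBetti.map f k c := by
    rw [← map_sum, A.sum_typeProj]
  have huniq : ∀ t, B.typeProj k t (complexBetti.map f k c) = complexBetti.map f k (A.typeProj k t c) :=
    B.typeProj_eq_of_sum_eq hmem hsum
  have hfc : complexBetti.map f k c ∈ B.typePiece k pq := (B.mem_typePiece_iff_isOfHodgeType hY pq _).2 hc
  have hzero : ∀ t, t ≠ pq → A.typeProj k t c = 0 := fun t ht ↦ hf (by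
    rw [← huniq, map_zero]
    exact B.typeProj_apply_of_mem_ne (Ne.symm ht) hfc)
  have hc' : c = A.typeProj k pq c := by
    conv_lhs => rw [← A.sum_typeProj k c]
    rw [Finset.sum_eq_single pq (fun t _ ht ↦ hzero t ht) (fun h ↦ absurd (Finset.mem_univ _) h)]
  rw [hc']
  exact (A.mem_typePiece_iff_isOfHodgeType hX pq _).1 (A.typeProj_mem k pq c)

/-- **Transport of a type along a typed expansion.** Let `S : Hᵏ(Y(ℂ); ℂ) → Hᵏ(X(ℂ); ℂ)` be
`ℂ`-linear, and let `z = Σ_ω w_ω` be a finite expansion of a class `z` of type `(p, q)` (read in a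
model `MY` of `Y`) into classes `w_ω` of pure types `τ(ω)` such that each `S w_ω` is of type `τ(ω)`
(read in a model `MX` of `X`). Then `S z` is of type `(p, q)`: grouping the `w_ω` by type gives the
type decomposition of `z` (uniqueness, `typeProj_eq_of_sum_eq`), whose components of type
`≠ (p, q)` vanish, so `S z = Σ_{τ(ω) = (p,q)} S w_ω`. [cite: VoisinHodgeI2002, Thm. 6.18 and §7.1.1] -/
theorem HodgeModel.mem_typePiece_map_of_sum_eq (MX : HodgeModel n X) (MY : HodgeModel m Y) {k : ℕ}
    (S : complexBetti Y k →ₗ[ℂ] complexBetti X k) {Ω : Type*} [Fintype Ω]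
    (τ : Ω → ↥(Finset.HasAntidiagonal.antidiagonal k)) (w : Ω → complexBetti Y k)
    (hw : ∀ ω, w ω ∈ MY.typePiece k (τ ω)) (hSw : ∀ ω, S (w ω) ∈ MX.typePiece k (τ ω))
    {pq : ↥(Finset.HasAntidiagonal.antidiagonal k)} {z : complexBetti Y k} (hz : z ∈ MY.typePiece k pq)
    (hsum : ∑ ω, w ω = z) : S z ∈ MX.typePiece k pq := by
  classical
  set zT : ↥(Finset.HasAntidiagonal.antidiagonal k) → complexBetti Y k :=
    fun T ↦ ∑ ω ∈ Finset.univ.filter (fun ω ↦ τ ω = T), w ω with hzT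
  have hzT_mem : ∀ T, zT T ∈ MY.typePiece k T := fun T ↦
    Submodule.sum_mem _ fun ω hω ↦ by
      rw [Finset.mem_filter] at hω
      rw [← hω.2]
      exact hw ω
  have hzT_sum : ∑ T, zT T = z := by
    rw [hzT, Finset.sum_fiberwise_of_maps_to (fun ω _ ↦ Finset.mem_univ (τ ω))]
    exact hsum
  have hproj : ∀ T, MY.typeProj k T z = zT T := MY.typeProj_eq_of_sum_eq hzT_mem hzT_sum
  have hzeq : z = zT pq := by rw [← hproj]; exact (MY.typeProj_apply_of_mem hz).symm
  rw [hzeq, hzT, map_sum]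
  exact Submodule.sum_mem _ fun ω hω ↦ by
    rw [Finset.mem_filter] at hω
    rw [← hω.2]
    exact hSw ω

end Types

/-! ### 3. The Leray–Hirsch comparison map on a single component and as a sum over the index -/

section LerayHirschSums

universe u w

variable {R : Type u} [CommRing R] {ι : Type w} [Fintype ι] (d : ι → ℕ)
  {E B : Type u} [TopologicalSpace E] [TopologicalSpace B]

/-- `θ(δ_J y) = q^* y ∪ c_J`: the comparison map on a family supported at one index.
[cite: HatcherAT2002, §3.2 Thm. 3.16] -/
theorem LerayHirsch.lhMap_single [DecidableEq ι] (q : C(E, B))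
    (c : (j : ι) → singularCohomology R R E (d j)) (k : ℕ) (J : LerayHirsch.Idx d k)
    (y : singularCohomology R R B (k - d J.1)) :
    LerayHirsch.lhMap R d q c k (Pi.single J y) =
      cupProduct (Nat.sub_add_cancel J.2) (singularCohomology.map R R q (k - d J.1) y) (c J.1) := by
  rw [LerayHirsch.lhMap_apply, Finset.sum_eq_single J.1]
  · rw [dif_pos J.2]
    have hJ : (Pi.single J y : LerayHirsch.Src R d B k) ⟨J.1, J.2⟩ = y := by simp
    rw [hJ]
  · intro j _ hj
    split_ifs with h
    · have hne : (⟨j, h⟩ : LerayHirsch.Idx d k) ≠ J := fun heq ↦ hj (congrArg Subtype.val heq)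
      rw [Pi.single_eq_of_ne hne, map_zero, map_zero, LinearMap.zero_apply]
    · rfl
  · exact fun h ↦ absurd (Finset.mem_univ _) h

/-- `θ(a) = Σ_J q^* a_J ∪ c_J`, summed over the indices `J` with `d J ≤ k`.
[cite: HatcherAT2002, §3.2 Thm. 3.16] -/
theorem LerayHirsch.lhMap_eq_sum_idx (q : C(E, B)) (c : (j : ι) → singularCohomology R R E (d j))
    (k : ℕ) (a : LerayHirsch.Src R d B k) :
    LerayHirsch.lhMap R d q c k a = ∑ J : LerayHirsch.Idx d k,
      cupProduct (Nat.sub_add_cancel J.2) (singularCohomology.map R R q (k - d J.1) (a J)) (c J.1) := by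
  classical
  conv_lhs => rw [← Finset.univ_sum_single a]
  rw [map_sum]
  exact Finset.sum_congr rfl fun J _ ↦ LerayHirsch.lhMap_single d q c k J (a J)

end LerayHirschSums

/-! ### 4. The Künneth step: sections of `f^*` and `f'^*` tensor to a section of `(f × f')^*` -/

section Kunneth

variable {mY mY' nX nX' : ℕ} {Y Y' X X' : SchemeOver ℂ} {σ : Fin (2 * mY' + 1) → Type}
  [∀ j, Fintype (σ j)]

/-- **The tensor of two sections, through the Künneth decomposition.** For bases `b j` of the
`Hʲ(Y'(ℂ); ℂ)` (`j ≤ 2 dim Y'`) and linear maps `s_i : Hⁱ(Y(ℂ)) → Hⁱ(X(ℂ))`,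
`s'_j : Hʲ(Y'(ℂ)) → Hʲ(X'(ℂ))`, there is a linear `S : Hᵏ((Y ⊗ Y')(ℂ)) → Hᵏ((X ⊗ X')(ℂ))` with
`S(Σ_J pr₁^* a_J ∪ pr₂^* b_J) = Σ_J pr₁^* s(a_J) ∪ pr₂^* s'(b_J)` — well defined because the
Künneth expansion along the `pr₂^* b_J` is unique (`complexBetti_kunneth_bijective`, Hatcher
Thm. 3.16). [cite: HatcherAT2002, §3.2 Thm. 3.15–3.16] -/
theorem exists_kunnethSection (hY : IsSmoothProjective mY Y) (hY' : IsSmoothProjective mY' Y')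
    (b : (j : Fin (2 * mY' + 1)) → Module.Basis (σ j) ℂ (complexBetti Y' j))
    (s : ∀ i, complexBetti Y i →ₗ[ℂ] complexBetti X i)
    (s' : ∀ i, complexBetti Y' i →ₗ[ℂ] complexBetti X' i) (k : ℕ) :
    ∃ S : complexBetti (Y ⊗ Y') k →ₗ[ℂ] complexBetti (X ⊗ X') k,
      ∀ a : LerayHirsch.Src ℂ (fun J : (Σ j, σ j) ↦ (J.1 : ℕ)) (ComplexPoints Y) k,
        S (LerayHirsch.lhMap ℂ (fun J : (Σ j, σ j) ↦ (J.1 : ℕ))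
            (AlgPoints.mapContinuous (L := ℂ) (fst Y Y'))
            (fun J ↦ complexBetti.map (snd Y Y') J.1 (b J.1 J.2)) k a) =
          LerayHirsch.lhMap ℂ (fun J : (Σ j, σ j) ↦ (J.1 : ℕ))
            (AlgPoints.mapContinuous (L := ℂ) (fst X X'))
            (fun J ↦ complexBetti.map (snd X X') J.1 (s' J.1 (b J.1 J.2))) k
            (fun J ↦ s (k - (J.1.1 : ℕ)) (a J)) := by
  set E := LinearEquiv.ofBijective _ (complexBetti_kunneth_bijective hY hY' b k) with hE
  let sPi : LerayHirsch.Src ℂ (fun J : (Σ j, σ j) ↦ (J.1 : ℕ)) (ComplexPoints Y) k →ₗ[ℂ]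
      LerayHirsch.Src ℂ (fun J : (Σ j, σ j) ↦ (J.1 : ℕ)) (ComplexPoints X) k :=
    LinearMap.pi fun J ↦ (s (k - (J.1.1 : ℕ))) ∘ₗ LinearMap.proj J
  refine ⟨(LerayHirsch.lhMap ℂ (fun J : (Σ j, σ j) ↦ (J.1 : ℕ))
      (AlgPoints.mapContinuous (L := ℂ) (fst X X'))
      (fun J ↦ complexBetti.map (snd X X') J.1 (s' J.1 (b J.1 J.2))) k) ∘ₗ sPi ∘ₗ E.symm.toLinearMap,
    fun a ↦ ?_⟩
  have ha : E.symm (LerayHirsch.lhMap ℂ (fun J : (Σ j, σ j) ↦ (J.1 : ℕ))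
      (AlgPoints.mapContinuous (L := ℂ) (fst Y Y'))
      (fun J ↦ complexBetti.map (snd Y Y') J.1 (b J.1 J.2)) k a) = a := E.symm_apply_apply a
  simp only [LinearMap.coe_comp, LinearEquiv.coe_coe, Function.comp_apply, ha]
  rfl

/-- **The tensor of two sections is a section**: if `f^* ∘ s = 𝟙` and `f'^* ∘ s' = 𝟙` in every
degree, then `(f × f')^* ∘ S = 𝟙` on `Hᵏ((Y ⊗ Y')(ℂ); ℂ)` (naturality of the Künneth expansion:
`(f × f')^*(pr₁^* x ∪ pr₂^* x') = pr₁^* f^* x ∪ pr₂^* f'^* x'`). [cite: HatcherAT2002, §3.2 Thm. 3.16 and Prop. 3.10] -/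
theorem kunnethSection_map (hY : IsSmoothProjective mY Y) (hY' : IsSmoothProjective mY' Y')
    (b : (j : Fin (2 * mY' + 1)) → Module.Basis (σ j) ℂ (complexBetti Y' j))
    (f : Y ⟶ X) (f' : Y' ⟶ X')
    (s : ∀ i, complexBetti Y i →ₗ[ℂ] complexBetti X i)
    (s' : ∀ i, complexBetti Y' i →ₗ[ℂ] complexBetti X' i)
    (hs : ∀ i (y : complexBetti Y i), complexBetti.map f i (s i y) = y)
    (hs' : ∀ i (y : complexBetti Y' i), complexBetti.map f' i (s' i y) = y) (k : ℕ)
    (S : complexBetti (Y ⊗ Y') k →ₗ[ℂ] complexBetti (X ⊗ X') k)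
    (hS : ∀ a : LerayHirsch.Src ℂ (fun J : (Σ j, σ j) ↦ (J.1 : ℕ)) (ComplexPoints Y) k,
        S (LerayHirsch.lhMap ℂ (fun J : (Σ j, σ j) ↦ (J.1 : ℕ))
            (AlgPoints.mapContinuous (L := ℂ) (fst Y Y'))
            (fun J ↦ complexBetti.map (snd Y Y') J.1 (b J.1 J.2)) k a) =
          LerayHirsch.lhMap ℂ (fun J : (Σ j, σ j) ↦ (J.1 : ℕ))
            (AlgPoints.mapContinuous (L := ℂ) (fst X X'))
            (fun J ↦ complexBetti.map (snd X X') J.1 (s' J.1 (b J.1 J.2))) k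
            (fun J ↦ s (k - (J.1.1 : ℕ)) (a J)))
    (z : complexBetti (Y ⊗ Y') k) : complexBetti.map (f ⊗ₘ f') k (S z) = z := by
  obtain ⟨a, rfl⟩ := (complexBetti_kunneth_bijective hY hY' b k).2 z
  rw [hS]
  have hsq : (AlgPoints.mapContinuous (L := ℂ) (fst X X')).comp
      (AlgPoints.mapContinuous (L := ℂ) (f ⊗ₘ f')) =
      (AlgPoints.mapContinuous (L := ℂ) f).comp (AlgPoints.mapContinuous (L := ℂ) (fst Y Y')) := by
    rw [← AlgPoints.mapContinuous_comp, ← AlgPoints.mapContinuous_comp, tensorHom_fst]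
  change singularCohomology.map ℂ ℂ (AlgPoints.mapContinuous (L := ℂ) (f ⊗ₘ f')) k _ = _
  rw [LerayHirsch.map_lhMap ℂ _ _ _ _ _ hsq]
  have hc : (fun J : (Σ j, σ j) ↦ singularCohomology.map ℂ ℂ (AlgPoints.mapContinuous (L := ℂ) (f ⊗ₘ f'))
      ((fun J : (Σ j, σ j) ↦ (J.1 : ℕ)) J) (complexBetti.map (snd X X') J.1 (s' J.1 (b J.1 J.2)))) =
      fun J : (Σ j, σ j) ↦ complexBetti.map (snd Y Y') J.1 (b J.1 J.2) := by
    funext J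
    change complexBetti.map (f ⊗ₘ f') _ (complexBetti.map (snd X X') _ _) = _
    rw [← complexBetti.map_comp_apply', tensorHom_snd, complexBetti.map_comp_apply', hs']
  have ha : (fun J : LerayHirsch.Idx (fun J : (Σ j, σ j) ↦ (J.1 : ℕ)) k ↦
      singularCohomology.map ℂ ℂ (AlgPoints.mapContinuous (L := ℂ) f)
        (k - (fun J : (Σ j, σ j) ↦ (J.1 : ℕ)) J.1) (s (k - (J.1.1 : ℕ)) (a J))) = a := by
    funext J
    exact hs _ (a J)
  rw [hc, ha]

/-- **The product formula for the tensor of two sections**: `S(pr₁^* y ∪ pr₂^* y') =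
pr₁^* s(y) ∪ pr₂^* s'(y')` for ALL `y ∈ H^{k-j}(Y(ℂ))`, `y' ∈ Hʲ(Y'(ℂ))` (expand `y'` in the basis
`b j`; both sides are linear in `y'`). [cite: HatcherAT2002, §3.2 Thm. 3.16] -/
theorem kunnethSection_cup (hY' : IsSmoothProjective mY' Y')
    (b : (j : Fin (2 * mY' + 1)) → Module.Basis (σ j) ℂ (complexBetti Y' j))
    (s : ∀ i, complexBetti Y i →ₗ[ℂ] complexBetti X i)
    (s' : ∀ i, complexBetti Y' i →ₗ[ℂ] complexBetti X' i) (k : ℕ)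
    (S : complexBetti (Y ⊗ Y') k →ₗ[ℂ] complexBetti (X ⊗ X') k)
    (hS : ∀ a : LerayHirsch.Src ℂ (fun J : (Σ j, σ j) ↦ (J.1 : ℕ)) (ComplexPoints Y) k,
        S (LerayHirsch.lhMap ℂ (fun J : (Σ j, σ j) ↦ (J.1 : ℕ))
            (AlgPoints.mapContinuous (L := ℂ) (fst Y Y'))
            (fun J ↦ complexBetti.map (snd Y Y') J.1 (b J.1 J.2)) k a) =
          LerayHirsch.lhMap ℂ (fun J : (Σ j, σ j) ↦ (J.1 : ℕ))
            (AlgPoints.mapContinuous (L := ℂ) (fst X X'))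
            (fun J ↦ complexBetti.map (snd X X') J.1 (s' J.1 (b J.1 J.2))) k
            (fun J ↦ s (k - (J.1.1 : ℕ)) (a J)))
    {j : ℕ} (hj : j ≤ k) (y : complexBetti Y (k - j)) (y' : complexBetti Y' j) :
    S (cupProduct (Nat.sub_add_cancel hj) (complexBetti.map (fst Y Y') (k - j) y)
        (complexBetti.map (snd Y Y') j y')) =
      cupProduct (Nat.sub_add_cancel hj) (complexBetti.map (fst X X') (k - j) (s (k - j) y))
        (complexBetti.map (snd X X') j (s' j y')) := by
  classical
  by_cases hj2 : 2 * mY' < j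
  · haveI := subsingleton_complexBetti hY' hj2
    rw [Subsingleton.elim y' 0]
    simp only [map_zero]
  · have hj2' : j < 2 * mY' + 1 := by omega
    let jf : Fin (2 * mY' + 1) := ⟨j, hj2'⟩
    -- both sides are linear in `y'`: compare them on the basis `b jf`
    suffices h : S ∘ₗ (cupProduct (Nat.sub_add_cancel hj) (complexBetti.map (fst Y Y') (k - j) y)) ∘ₗ
        (complexBetti.map (snd Y Y') j).hom =
        (cupProduct (Nat.sub_add_cancel hj) (complexBetti.map (fst X X') (k - j) (s (k - j) y))) ∘ₗ
          (complexBetti.map (snd X X') j).hom ∘ₗ s' j from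
      LinearMap.congr_fun h y'
    refine (b jf).ext fun i ↦ ?_
    simp only [LinearMap.coe_comp, Function.comp_apply]
    let J : LerayHirsch.Idx (fun J : (Σ j, σ j) ↦ (J.1 : ℕ)) k := ⟨⟨jf, i⟩, hj⟩
    have h1 := hS (Pi.single J y)
    have hsingle : (fun J' : LerayHirsch.Idx (fun J : (Σ j, σ j) ↦ (J.1 : ℕ)) k ↦
        s (k - (J'.1.1 : ℕ))
          ((Pi.single J y : LerayHirsch.Src ℂ (fun J : (Σ j, σ j) ↦ (J.1 : ℕ)) (ComplexPoints Y) k) J')) =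
        (Pi.single J (s (k - j) y) : LerayHirsch.Src ℂ (fun J : (Σ j, σ j) ↦ (J.1 : ℕ)) (ComplexPoints X) k) := by
      funext J'
      exact @Pi.apply_single (LerayHirsch.Idx (fun J : (Σ j, σ j) ↦ (J.1 : ℕ)) k)
        (fun J' ↦ (complexBetti Y (k - (J'.1.1 : ℕ)) : Type))
        (fun J' ↦ (complexBetti X (k - (J'.1.1 : ℕ)) : Type)) _ _ _
        (fun J' x ↦ s (k - (J'.1.1 : ℕ)) x) (fun _ ↦ map_zero _) J y J'
    rw [hsingle, LerayHirsch.lhMap_single, LerayHirsch.lhMap_single] at h1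
    exact h1

/-- **The tensor of two rational sections is rational**: if the `b j i`, the `s(y)` (`y` rational)
and the `s'(y')` (`y'` rational) are rational classes, then `S` maps rational classes to rational
classes. The Künneth coefficients `a_J` of a rational class along the rational `pr₂^* b_J` are
rational: the `pr₁^* y_l ∪ pr₂^* b_J` (`y_l` running through rational bases of the `Hⁱ(Y(ℂ))`)
form a `ℂ`-basis of `Hᵏ((Y ⊗ Y')(ℂ))` made of rational classes, along which rational classes have
rational coordinates (`IsRationalClass.coeff_mem_range_of_linearIndependent`).
[cite: HatcherAT2002, §3.2 Thm. 3.16 and §3.1 p. 198] [cite: VoisinHodgeI2002, §7.1.1 and Thm. 11.38] -/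
theorem kunnethSection_isRationalClass (hY : IsSmoothProjective mY Y) (hY' : IsSmoothProjective mY' Y')
    (b : (j : Fin (2 * mY' + 1)) → Module.Basis (σ j) ℂ (complexBetti Y' j))
    (hb : ∀ j i, IsRationalClass (b j i))
    (s : ∀ i, complexBetti Y i →ₗ[ℂ] complexBetti X i)
    (s' : ∀ i, complexBetti Y' i →ₗ[ℂ] complexBetti X' i)
    (hs : ∀ i (y : complexBetti Y i), IsRationalClass y → IsRationalClass (s i y))
    (hs' : ∀ i (y : complexBetti Y' i), IsRationalClass y → IsRationalClass (s' i y)) (k : ℕ)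
    (S : complexBetti (Y ⊗ Y') k →ₗ[ℂ] complexBetti (X ⊗ X') k)
    (hS : ∀ a : LerayHirsch.Src ℂ (fun J : (Σ j, σ j) ↦ (J.1 : ℕ)) (ComplexPoints Y) k,
        S (LerayHirsch.lhMap ℂ (fun J : (Σ j, σ j) ↦ (J.1 : ℕ))
            (AlgPoints.mapContinuous (L := ℂ) (fst Y Y'))
            (fun J ↦ complexBetti.map (snd Y Y') J.1 (b J.1 J.2)) k a) =
          LerayHirsch.lhMap ℂ (fun J : (Σ j, σ j) ↦ (J.1 : ℕ))
            (AlgPoints.mapContinuous (L := ℂ) (fst X X'))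
            (fun J ↦ complexBetti.map (snd X X') J.1 (s' J.1 (b J.1 J.2))) k
            (fun J ↦ s (k - (J.1.1 : ℕ)) (a J)))
    {z : complexBetti (Y ⊗ Y') k} (hz : IsRationalClass z) : IsRationalClass (S z) := by
  classical
  obtain ⟨a, rfl⟩ := (complexBetti_kunneth_bijective hY hY' b k).2 z
  -- the Künneth coefficients `a J` of the rational class `z` are rational
  have ha : ∀ J, IsRationalClass (a J) := by
    choose r bY hbY using fun i ↦ exists_basis_isRationalClass hY i
    let E := LinearEquiv.ofBijective _ (complexBetti_kunneth_bijective hY hY' b k)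
    let P : Module.Basis (Σ J : LerayHirsch.Idx (fun J : (Σ j, σ j) ↦ (J.1 : ℕ)) k, Fin (r (k - (J.1.1 : ℕ)))) ℂ
        (LerayHirsch.Src ℂ (fun J : (Σ j, σ j) ↦ (J.1 : ℕ)) (ComplexPoints Y) k) :=
      Pi.basis fun J ↦ bY (k - (J.1.1 : ℕ))
    let v := P.map E
    have hv : ∀ Jl, IsRationalClass (v Jl) := by
      rintro ⟨J, l⟩
      change IsRationalClass (E (P ⟨J, l⟩))
      rw [Pi.basis_apply]
      change IsRationalClass (LerayHirsch.lhMap ℂ (fun J : (Σ j, σ j) ↦ (J.1 : ℕ))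
        (AlgPoints.mapContinuous (L := ℂ) (fst Y Y'))
        (fun J ↦ complexBetti.map (snd Y Y') J.1 (b J.1 J.2)) k (Pi.single J (bY _ l)))
      rw [LerayHirsch.lhMap_single]
      exact ((hbY _ l).map _).cup _ ((hb _ _).map _)
    have hrepr : ∀ Jl, v.repr (E a) Jl = P.repr a Jl := fun Jl ↦ by
      rw [Module.Basis.map_repr, LinearEquiv.trans_apply, E.symm_apply_apply]
    have hexp : E a = ∑ Jl, (v.repr (E a) Jl) • v Jl := (v.sum_repr (E a)).symm
    have hz' : IsRationalClass (∑ Jl, (v.repr (E a) Jl) • v Jl) := by rw [← hexp]; exact hz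
    have hcoef : ∀ Jl, v.repr (E a) Jl ∈ Set.range (algebraMap ℚ ℂ) := fun Jl ↦
      IsRationalClass.coeff_mem_range_of_linearIndependent hv v.linearIndependent hz' Jl
    intro J
    have haJ : a J = ∑ l, (P.repr a ⟨J, l⟩) • bY (k - (J.1.1 : ℕ)) l := by
      conv_lhs => rw [← (bY (k - (J.1.1 : ℕ))).sum_repr (a J)]
      refine Finset.sum_congr rfl fun l _ ↦ ?_
      rw [Pi.basis_repr]
    choose q hq using fun l ↦ hcoef ⟨J, l⟩
    have haJ' : a J = ∑ l, ((q l : ℚ) : ℂ) • bY (k - (J.1.1 : ℕ)) l := by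
      rw [haJ]
      refine Finset.sum_congr rfl fun l _ ↦ ?_
      rw [← hrepr, ← hq l]
      rfl
    rw [haJ']
    exact IsRationalClass.sum_smul _ (fun l ↦ hbY _ l) q
  rw [hS, LerayHirsch.lhMap_eq_sum_idx]
  refine isRationalClass_sum _ _ fun J _ ↦ ?_
  exact ((hs _ _ (ha J)).map _).cup _ ((hs' _ _ (hb _ _)).map _)

/-- **The tensor of two type-preserving sections preserves Hodge types.** If `s` and `s'`
preserve the Hodge types `(p, q)`, `p + q = degree`, then so does `S` (all four varieties smooth
projective, products of dimensions `dim Y + dim Y'`, `dim X + dim X'`). Expand a class `z` of type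
`(p, q)` along the Künneth basis, then each coefficient `a_J` and each `b_J` into its components
of pure type: `z = Σ_ω w_ω` with `w_ω = pr₁^* π_{t'} a_J ∪ pr₂^* π_t b_J` of pure type `t' + t`
(types add under exterior products, Voisin I Thm. 11.38 — the tree's
`isOfHodgeType_cupProduct_map_map_of_cupPreservesHodgeType` with de Rham's theorem
`exists_deRhamIsoFamily_holds`), and `S w_ω = pr₁^* s(π_{t'} a_J) ∪ pr₂^* s'(π_t b_J)` (product
formula) is of the same type; conclude by `HodgeModel.mem_typePiece_map_of_sum_eq`.
[cite: VoisinHodgeI2002, Thm. 6.18, §7.1.1 and §11.3.2 Thm. 11.38] -/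
theorem kunnethSection_isOfHodgeType (hY : IsSmoothProjective mY Y) (hY' : IsSmoothProjective mY' Y')
    (hX : IsSmoothProjective nX X) (hX' : IsSmoothProjective nX' X')
    (b : (j : Fin (2 * mY' + 1)) → Module.Basis (σ j) ℂ (complexBetti Y' j))
    (s : ∀ i, complexBetti Y i →ₗ[ℂ] complexBetti X i)
    (s' : ∀ i, complexBetti Y' i →ₗ[ℂ] complexBetti X' i)
    (hs : ∀ i p q (y : complexBetti Y i), p + q = i → IsOfHodgeType mY Y i p q y →
      IsOfHodgeType nX X i p q (s i y))
    (hs' : ∀ i p q (y : complexBetti Y' i), p + q = i → IsOfHodgeType mY' Y' i p q y →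
      IsOfHodgeType nX' X' i p q (s' i y)) (k : ℕ)
    (S : complexBetti (Y ⊗ Y') k →ₗ[ℂ] complexBetti (X ⊗ X') k)
    (hS : ∀ a : LerayHirsch.Src ℂ (fun J : (Σ j, σ j) ↦ (J.1 : ℕ)) (ComplexPoints Y) k,
        S (LerayHirsch.lhMap ℂ (fun J : (Σ j, σ j) ↦ (J.1 : ℕ))
            (AlgPoints.mapContinuous (L := ℂ) (fst Y Y'))
            (fun J ↦ complexBetti.map (snd Y Y') J.1 (b J.1 J.2)) k a) =
          LerayHirsch.lhMap ℂ (fun J : (Σ j, σ j) ↦ (J.1 : ℕ))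
            (AlgPoints.mapContinuous (L := ℂ) (fst X X'))
            (fun J ↦ complexBetti.map (snd X X') J.1 (s' J.1 (b J.1 J.2))) k
            (fun J ↦ s (k - (J.1.1 : ℕ)) (a J)))
    {p q : ℕ} (hpq : p + q = k) {z : complexBetti (Y ⊗ Y') k}
    (hz : IsOfHodgeType (mY + mY') (Y ⊗ Y') k p q z) :
    IsOfHodgeType (nX + nX') (X ⊗ X') k p q (S z) := by
  classical
  have hYY' : IsSmoothProjective (mY + mY') (Y ⊗ Y') := IsSmoothProjective.tensor_holds hY hY'
  have hXX' : IsSmoothProjective (nX + nX') (X ⊗ X') := IsSmoothProjective.tensor_holds hX hX'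
  obtain ⟨MY⟩ := nonempty_hodgeModel_holds (n := mY + mY') (X := Y ⊗ Y') hYY'
  obtain ⟨MX⟩ := nonempty_hodgeModel_holds (n := nX + nX') (X := X ⊗ X') hXX'
  obtain ⟨A⟩ := nonempty_hodgeModel_holds (n := mY) (X := Y) hY
  obtain ⟨A'⟩ := nonempty_hodgeModel_holds (n := mY') (X := Y') hY'
  have hdR : ∀ (E : Type) [NormedAddCommGroup E] [NormedSpace ℂ E] [FiniteDimensional ℂ E],
      Literature.NumberTheory.Transcendental.exists_deRhamIsoFamily (modelWithCornersSelf ℝ E) :=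
    fun E _ _ _ ↦ Literature.NumberTheory.Transcendental.exists_deRhamIsoFamily_holds E
  have hcupY : CupPreservesHodgeType (mY + mY') (Y ⊗ Y') :=
    cupPreservesHodgeType_of_multiplicative_deRham hdR hYY'
  have hcupX : CupPreservesHodgeType (nX + nX') (X ⊗ X') :=
    cupPreservesHodgeType_of_multiplicative_deRham hdR hXX'
  obtain ⟨a, rfl⟩ := (complexBetti_kunneth_bijective hY hY' b k).2 z
  let pq : ↥(Finset.HasAntidiagonal.antidiagonal k) :=
    ⟨(p, q), Finset.HasAntidiagonal.mem_antidiagonal.2 hpq⟩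
  -- the typed expansion of `z`
  let Ω := Σ J : LerayHirsch.Idx (fun J : (Σ j, σ j) ↦ (J.1 : ℕ)) k,
    (↥(Finset.HasAntidiagonal.antidiagonal (k - (J.1.1 : ℕ))) ×
      ↥(Finset.HasAntidiagonal.antidiagonal (J.1.1 : ℕ)))
  let τ : Ω → ↥(Finset.HasAntidiagonal.antidiagonal k) := fun ω ↦
    ⟨(ω.2.1.1.1 + ω.2.2.1.1, ω.2.1.1.2 + ω.2.2.1.2), Finset.HasAntidiagonal.mem_antidiagonal.2 (by
      have h1 := Finset.HasAntidiagonal.mem_antidiagonal.1 ω.2.1.2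
      have h2 := Finset.HasAntidiagonal.mem_antidiagonal.1 ω.2.2.2
      have h3 := ω.1.2
      change (ω.1.1.1 : ℕ) ≤ k at h3
      change ω.2.1.1.1 + ω.2.2.1.1 + (ω.2.1.1.2 + ω.2.2.1.2) = k
      omega)⟩
  let w : Ω → complexBetti (Y ⊗ Y') k := fun ω ↦ cupProduct (Nat.sub_add_cancel ω.1.2)
    (complexBetti.map (fst Y Y') _ (A.typeProj _ ω.2.1 (a ω.1)))
    (complexBetti.map (snd Y Y') _ (A'.typeProj _ ω.2.2 (b ω.1.1.1 ω.1.1.2)))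
  have hw : ∀ ω, w ω ∈ MY.typePiece k (τ ω) := fun ω ↦
    (MY.mem_typePiece_iff_isOfHodgeType hYY' (τ ω) _).2
      (isOfHodgeType_cupProduct_map_map_of_cupPreservesHodgeType hYY' hY hY' (fst Y Y') (snd Y Y')
        hcupY _ ((A.mem_typePiece_iff_isOfHodgeType hY _ _).1 (A.typeProj_mem _ _ _))
        ((A'.mem_typePiece_iff_isOfHodgeType hY' _ _).1 (A'.typeProj_mem _ _ _)))
  have hSw : ∀ ω, S (w ω) ∈ MX.typePiece k (τ ω) := fun ω ↦ by
    refine (MX.mem_typePiece_iff_isOfHodgeType hXX' (τ ω) _).2 ?_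
    change IsOfHodgeType (nX + nX') (X ⊗ X') k _ _ (S (cupProduct (Nat.sub_add_cancel ω.1.2)
      (complexBetti.map (fst Y Y') _ (A.typeProj _ ω.2.1 (a ω.1)))
      (complexBetti.map (snd Y Y') _ (A'.typeProj _ ω.2.2 (b ω.1.1.1 ω.1.1.2)))))
    rw [kunnethSection_cup hY' b s s' k S hS ω.1.2]
    exact isOfHodgeType_cupProduct_map_map_of_cupPreservesHodgeType hXX' hX hX' (fst X X') (snd X X')
      hcupX _
      (hs _ _ _ _ (Finset.HasAntidiagonal.mem_antidiagonal.1 ω.2.1.2)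
        ((A.mem_typePiece_iff_isOfHodgeType hY _ _).1 (A.typeProj_mem _ _ _)))
      (hs' _ _ _ _ (Finset.HasAntidiagonal.mem_antidiagonal.1 ω.2.2.2)
        ((A'.mem_typePiece_iff_isOfHodgeType hY' _ _).1 (A'.typeProj_mem _ _ _)))
  have hsum : ∑ ω, w ω = LerayHirsch.lhMap ℂ (fun J : (Σ j, σ j) ↦ (J.1 : ℕ))
      (AlgPoints.mapContinuous (L := ℂ) (fst Y Y'))
      (fun J ↦ complexBetti.map (snd Y Y') J.1 (b J.1 J.2)) k a := by
    rw [LerayHirsch.lhMap_eq_sum_idx, Fintype.sum_sigma]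
    refine Finset.sum_congr rfl fun J _ ↦ ?_
    change ∑ tt : ↥(Finset.HasAntidiagonal.antidiagonal (k - (J.1.1 : ℕ))) ×
        ↥(Finset.HasAntidiagonal.antidiagonal (J.1.1 : ℕ)),
      cupProduct (Nat.sub_add_cancel J.2)
        (complexBetti.map (fst Y Y') _ (A.typeProj _ tt.1 (a J)))
        (complexBetti.map (snd Y Y') _ (A'.typeProj _ tt.2 (b J.1.1 J.1.2))) =
      cupProduct (Nat.sub_add_cancel J.2) (complexBetti.map (fst Y Y') _ (a J))
        (complexBetti.map (snd Y Y') _ (b J.1.1 J.1.2))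
    have e1 : complexBetti.map (fst Y Y') (k - (J.1.1 : ℕ)) (a J) =
        ∑ t', complexBetti.map (fst Y Y') (k - (J.1.1 : ℕ)) (A.typeProj _ t' (a J)) := by
      rw [← map_sum, A.sum_typeProj]
    have e2 : complexBetti.map (snd Y Y') (J.1.1 : ℕ) (b J.1.1 J.1.2) =
        ∑ t, complexBetti.map (snd Y Y') (J.1.1 : ℕ) (A'.typeProj _ t (b J.1.1 J.1.2)) := by
      rw [← map_sum, A'.sum_typeProj]
    rw [e1, e2, map_sum (cupProduct (Nat.sub_add_cancel J.2)), LinearMap.sum_apply, Fintype.sum_prod_type]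
    refine Finset.sum_congr rfl fun t' _ ↦ ?_
    rw [map_sum]
  exact (MX.mem_typePiece_iff_isOfHodgeType hXX' pq _).1
    (MX.mem_typePiece_map_of_sum_eq MY S τ w hw hSw
      ((MY.mem_typePiece_iff_isOfHodgeType hYY' pq _).2 hz) hsum)

end Kunneth

/-! ### 5. Linear algebra: the Casimir element of a perfect pairing does not depend on the basis -/

section Casimir

open scoped TensorProduct

variable {K : Type*} [Field K] {V L W : Type*} [AddCommGroup V] [Module K V] [AddCommGroup L]
  [Module K L] [AddCommGroup W] [Module K W]

/-- `Σᵢ εᵢ ⊗ eᵢ ∈ V^* ⊗ V` does not depend on the basis `(eᵢ)` (with dual functionals `εᵢ`): under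
`V^* ⊗ V ≅ End(V)` it is the identity. [folklore] -/
theorem sum_coord_tmul_eq {ι ι' : Type*} [Fintype ι] [Fintype ι'] (e : Module.Basis ι K V)
    (e' : Module.Basis ι' K V) :
    ∑ i, e.coord i ⊗ₜ[K] e i = ∑ i, e'.coord i ⊗ₜ[K] e' i := by
  classical
  apply (dualTensorHomEquivOfBasis (N := V) e).injective
  rw [dualTensorHomEquivOfBasis_apply, dualTensorHomEquivOfBasis_apply, map_sum, map_sum]
  refine LinearMap.ext fun v ↦ ?_
  rw [LinearMap.sum_apply, LinearMap.sum_apply]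
  simp only [dualTensorHom_apply, Module.Basis.coord_apply, Module.Basis.sum_repr]

/-- **The Casimir element of a perfect pairing is basis independent.** For an isomorphism
`Q♭ : V ≅ Hom(V, L)` (a perfect `L`-valued pairing), `w₀ ∈ L`, a bilinear `Θ : V × V → W` and two
bases `e`, `e'` of `V` with the "dual" families `dᵢ = (Q♭)⁻¹(εᵢ · w₀)` (so that `Q(dᵢ, eⱼ) = δᵢⱼ w₀`):
`Σᵢ Θ(dᵢ, eᵢ) = Σᵢ Θ(d'ᵢ, e'ᵢ)`. [folklore] -/
theorem sum_casimir_eq [FiniteDimensional K V] (QE : V ≃ₗ[K] (V →ₗ[K] L)) (w₀ : L)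
    (Θ : V →ₗ[K] V →ₗ[K] W) {ι ι' : Type*} [Fintype ι] [Fintype ι'] (e : Module.Basis ι K V)
    (e' : Module.Basis ι' K V) :
    ∑ i, Θ (QE.symm ((e.coord i).smulRight w₀)) (e i) =
      ∑ i, Θ (QE.symm ((e'.coord i).smulRight w₀)) (e' i) := by
  -- the linear map `φ ⊗ v ↦ Θ((Q♭)⁻¹(φ · w₀), v)`
  let T : Module.Dual K V →ₗ[K] (V →ₗ[K] L) := (LinearMap.smulRightₗ : (V →ₗ[K] K) →ₗ[K] L →ₗ[K] V →ₗ[K] L).flip w₀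
  let Φ : Module.Dual K V ⊗[K] V →ₗ[K] W :=
    TensorProduct.lift (Θ ∘ₗ QE.symm.toLinearMap ∘ₗ T)
  have hΦ : ∀ (φ : Module.Dual K V) (v : V), Φ (φ ⊗ₜ v) = Θ (QE.symm (φ.smulRight w₀)) v := fun φ v ↦ by
    rw [TensorProduct.lift.tmul]
    rfl
  calc ∑ i, Θ (QE.symm ((e.coord i).smulRight w₀)) (e i)
      = Φ (∑ i, e.coord i ⊗ₜ[K] e i) := by rw [map_sum]; exact Finset.sum_congr rfl fun i _ ↦ (hΦ _ _).symm
    _ = Φ (∑ i, e'.coord i ⊗ₜ[K] e' i) := by rw [sum_coord_tmul_eq e e']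
    _ = ∑ i, Θ (QE.symm ((e'.coord i).smulRight w₀)) (e' i) := by
        rw [map_sum]; exact Finset.sum_congr rfl fun i _ ↦ hΦ _ _

end Casimir

/-! ### 6. The curve: a section of `α^*`, `α = f^P : C → J`, degree by degree -/

section Curve

variable {m n : ℕ} {X Y : SchemeOver ℂ}

/-- The antidiagonal of `0` has the single element `(0, 0)`. [folklore] -/
theorem subsingleton_antidiagonal_zero : Subsingleton ↥(Finset.HasAntidiagonal.antidiagonal (0 : ℕ)) :=
  ⟨fun a b ↦ Subtype.ext (by
    have ha := Finset.HasAntidiagonal.mem_antidiagonal.1 a.2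
    have hb := Finset.HasAntidiagonal.mem_antidiagonal.1 b.2
    exact Prod.ext (by omega) (by omega))⟩

/-- **Every class of `H⁰(X(ℂ); ℂ)` is of type `(0, 0)`** (`X` smooth projective): `(0, 0)` is the
only type in degree `0`, and the type pieces exhaust. [cite: VoisinHodgeI2002, Thm. 6.18 and §7.1.1] -/
theorem isOfHodgeType_zero_zero_of_degree_zero (hX : IsSmoothProjective n X) (c : complexBetti X 0) :
    IsOfHodgeType n X 0 0 0 c := by
  obtain ⟨A⟩ := nonempty_hodgeModel_holds (n := n) (X := X) hX
  let t : ↥(Finset.HasAntidiagonal.antidiagonal (0 : ℕ)) :=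
    ⟨(0, 0), Finset.HasAntidiagonal.mem_antidiagonal.2 rfl⟩
  haveI := subsingleton_antidiagonal_zero
  have hsum : ∑ t', A.typeProj 0 t' c = A.typeProj 0 t c := Fintype.sum_subsingleton _ t
  rw [A.sum_typeProj] at hsum
  have hc : c ∈ A.typePiece 0 t := by rw [hsum]; exact A.typeProj_mem 0 t c
  exact (A.mem_typePiece_iff_isOfHodgeType hX t c).1 hc

/-- **Degree `0`: a section of `f^*` on `H⁰`** for a morphism `f : Y ⟶ X` of smooth projective
(hence path connected) varieties: `s₀(ε(y) · 1_Y) = ε(y) · 1_X`. It is a section (`f^* 1 = 1`),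
maps rational classes to rational classes (the coefficient of a rational class along the rational,
non-zero class `1` is rational) and every class of degree `0` is of type `(0, 0)`.
[cite: HatcherAT2002, §3.1 p. 199 and Prop. 3.10] [cite: VoisinHodgeI2002, §7.1.1] -/
theorem exists_section_degree_zero (hY : IsSmoothProjective m Y) (hX : IsSmoothProjective n X)
    (f : Y ⟶ X) :
    ∃ s₀ : complexBetti Y 0 →ₗ[ℂ] complexBetti X 0,
      (∀ y, complexBetti.map f 0 (s₀ y) = y) ∧
      (∀ y, IsRationalClass y → IsRationalClass (s₀ y)) ∧
      (∀ p q (y : complexBetti Y 0), p + q = 0 → IsOfHodgeType m Y 0 p q y →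
        IsOfHodgeType n X 0 p q (s₀ y)) := by
  haveI := pathConnectedSpace_complexPoints_of_isSmoothProjective hY
  haveI := pathConnectedSpace_complexPoints_of_isSmoothProjective hX
  let e := singularCohomologyZeroEquiv ℂ ℂ (ComplexPoints Y)
  refine ⟨(LinearMap.toSpanSingleton ℂ _ (singularCohomology.one ℂ (ComplexPoints X))) ∘ₗ e.toLinearMap,
    fun y ↦ ?_, fun y hy ↦ ?_, fun p q y hpq _ ↦ ?_⟩
  · change complexBetti.map f 0 (e y • singularCohomology.one ℂ (ComplexPoints X)) = y
    rw [map_smul]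
    change e y • singularCohomology.map ℂ ℂ _ 0 (singularCohomology.one ℂ _) = y
    rw [singularCohomology.map_one]
    exact (singularCohomology.eq_smul_one ℂ y).symm
  · change IsRationalClass (e y • singularCohomology.one ℂ (ComplexPoints X))
    -- the coefficient `ε(y)` of the rational class `y = ε(y) • 1` is rational
    have hone : (singularCohomology.one ℂ (ComplexPoints Y)) ≠ 0 := fun h0 ↦ by
      have h1 := singularCohomologyZeroEquiv_one (R := ℂ) (X := ComplexPoints Y)
      rw [h0, map_zero] at h1
      exact zero_ne_one h1
    have hli : LinearIndependent ℂ (fun _ : Unit ↦ singularCohomology.one ℂ (ComplexPoints Y)) :=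
      linearIndependent_unique_iff.2 hone
    have hz : IsRationalClass (∑ i : Unit, (fun _ ↦ e y) i •
        (fun _ : Unit ↦ singularCohomology.one ℂ (ComplexPoints Y)) i) := by
      rw [Fintype.sum_unique]
      change IsRationalClass (e y • singularCohomology.one ℂ (ComplexPoints Y))
      rw [← singularCohomology.eq_smul_one ℂ y]
      exact hy
    obtain ⟨r, hr⟩ := IsRationalClass.coeff_mem_range_of_linearIndependent
      (fun _ ↦ isRationalClass_one _) hli hz ()
    change algebraMap ℚ ℂ r = e y at hr
    rw [← hr, eq_ratCast]
    exact (isRationalClass_one _).smul r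
  · obtain ⟨rfl, rfl⟩ : p = 0 ∧ q = 0 := ⟨by omega, by omega⟩
    exact isOfHodgeType_zero_zero_of_degree_zero hX _

variable {C : SchemeOver ℂ}

/-- **Degree `1`: `s₁ = ((f^P)^*)⁻¹` on `H¹`**, granted the `H¹` fact
(`(f^P)^* : H¹(J(ℂ); ℂ) ≅ H¹(C(ℂ); ℂ)` is bijective, `bijective_complexBetti_map_abelJacobi`;
Lange §4.1.1 and proof of Lemma 4.4.1). It is a two-sided inverse; it maps rational classes to
rational classes (the fact over `ℚ` and `ι ∘ (f^P)^*_ℚ = (f^P)^*_ℂ ∘ ι`); and it preserves the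
Hodge types `(1, 0)`, `(0, 1)` (an injective pull-back detects types,
`IsOfHodgeType.of_map_of_injective`). [cite: Lange2023AbelianVarietiesC, §4.1.1 and Lemma 4.4.1 (proof)]
[cite: VoisinHodgeI2002, §7.3.2] -/
theorem exists_section_degree_one (h1 : isIso_bettiCohomology_map_abelJacobi)
    (hC : IsSmoothProjective 1 C) (𝒥 : Jacobian C) (P : AlgPoints C ℂ) :
    ∃ s₁ : complexBetti C 1 →ₗ[ℂ] complexBetti 𝒥.J.X 1,
      (∀ y, complexBetti.map (𝒥.abelJacobi P) 1 (s₁ y) = y) ∧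
      (∀ x, s₁ (complexBetti.map (𝒥.abelJacobi P) 1 x) = x) ∧
      (∀ y, IsRationalClass y → IsRationalClass (s₁ y)) ∧
      (∀ p q (y : complexBetti C 1), p + q = 1 → IsOfHodgeType 1 C 1 p q y →
        IsOfHodgeType 𝒥.J.dim 𝒥.J.X 1 p q (s₁ y)) := by
  have hbij := bijective_complexBetti_map_abelJacobi 𝒥 h1 hC P
  let e := LinearEquiv.ofBijective (complexBetti.map (𝒥.abelJacobi P) 1).hom hbij
  refine ⟨e.symm.toLinearMap, fun y ↦ e.apply_symm_apply y, fun x ↦ e.symm_apply_apply x,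
    fun y hy ↦ ?_, fun p q y hpq hy ↦ ?_⟩
  · obtain ⟨yq, rfl⟩ := hy.exists_ringChange_eq
    haveI := h1 C hC 𝒥 P
    obtain ⟨xq, hxq⟩ := (asIso (bettiCohomology.map (𝒥.abelJacobi P) 1)).toLinearEquiv.surjective yq
    have hxq' : bettiCohomology.map (𝒥.abelJacobi P) 1 xq = yq := hxq
    have he : e (singularCohomology.ringChange (algebraMap ℚ ℂ) _ 1 xq) =
        singularCohomology.ringChange (algebraMap ℚ ℂ) _ 1 yq := by
      rw [← hxq']
      exact (ringChange_map (AlgPoints.mapContinuous (L := ℂ) (𝒥.abelJacobi P)) xq).symm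
    change IsRationalClass (e.symm _)
    rw [← he, e.symm_apply_apply]
    exact isRationalClass_ringChange xq
  · refine IsOfHodgeType.of_map_of_injective hC AbelianVariety.isSmoothProjective_holds
      (𝒥.abelJacobi P) hpq hbij.1 ?_
    change IsOfHodgeType 1 C 1 p q (e (e.symm y))
    rwa [e.apply_symm_apply]

/-- **Degrees `≥ 3`: `Hᵏ(C(ℂ); ℂ) = 0`**, so `0` is a (rational, type-preserving) section there.
[cite: HatcherAT2002, §3.3 Thm. 3.26] -/
theorem exists_section_degree_ge_three (hC : IsSmoothProjective 1 C) (𝒥 : Jacobian C)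
    (g : C ⟶ 𝒥.J.X) {k : ℕ} (hk : 2 < k) :
    ∃ s : complexBetti C k →ₗ[ℂ] complexBetti 𝒥.J.X k,
      (∀ y, complexBetti.map g k (s y) = y) ∧
      (∀ y, IsRationalClass y → IsRationalClass (s y)) ∧
      (∀ p q (y : complexBetti C k), p + q = k → IsOfHodgeType 1 C k p q y →
        IsOfHodgeType 𝒥.J.dim 𝒥.J.X k p q (s y)) := by
  haveI := subsingleton_complexBetti hC (k := k) (by omega)
  obtain ⟨M⟩ := nonempty_hodgeModel_holds (n := 𝒥.J.dim) (X := 𝒥.J.X)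
    AbelianVariety.isSmoothProjective_holds
  exact ⟨0, fun y ↦ Subsingleton.elim _ _, fun y _ ↦ by rw [LinearMap.zero_apply]; exact IsRationalClass.zero,
    fun p q y _ _ ↦ by rw [LinearMap.zero_apply]; exact IsOfHodgeType.zero M k p q⟩

/-- **The theta class of `J` through `(f^P)^*` — degree `2`, no positivity needed.** Granted the
`H¹` fact, for `C` of genus `g ≥ 1` there are a non-zero rational class `w₀ ∈ H²(C(ℂ); ℂ)` and a
RATIONAL class `θ₀ ∈ H²(J(ℂ); ℂ)` of Hodge type `(1, 1)` with `(f^P)^* θ₀ = w₀`. Construction: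
`θ' = Σᵢ s₁(dᵢ) ∪ s₁(eᵢ)` for a basis `(eᵢ)` of `H¹(C(ℂ); ℚ)` and the dual family `(dᵢ)` for the
perfect cup pairing `⟨a ∪ b, [C(ℂ)]⟩` over `ℚ` (Poincaré duality over a field, Hatcher Prop. 3.38
— the tree's `isPerfPair_cupPairing_of_field_holds`); `(f^P)^* θ' = Σᵢ dᵢ ∪ eᵢ = 2g · w₀` and
`θ₀ = (2g)⁻¹ θ'`. The Casimir element `Σᵢ dᵢ ⊗ eᵢ` does not depend on the basis
(`sum_casimir_eq`); computed in a basis of `H¹(C(ℂ); ℂ) = H^{1,0} ⊕ H^{0,1}` adapted to the Hodge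
decomposition, the dual vector of a class of type `(1, 0)` is of type `(0, 1)` and conversely —
because `H^{1,0} ∪ H^{1,0} ⊆ H^{2,0}(C) = 0` and `H^{0,1} ∪ H^{0,1} ⊆ H^{0,2}(C) = 0` (a curve has no
`(2, 0)`-classes) and the pairing is perfect — so that every term `s₁(d'ᵢ) ∪ s₁(e'ᵢ)` is of type
`(1, 1)` (`s₁` preserves types; types add under `∪`, Voisin I Thm. 11.38 with de Rham's theorem).
Up to a rational factor this is the class of the theta divisor (Lange–Birkenhake, §4.2.1,
proof of Poincaré's Formula: in a symplectic basis `λ₁, …, λ_{2g}` of `H₁(C, ℤ) = H₁(J, ℤ)` the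
class of `W̃₁ = α(C)` is `-Σ_ν λ_ν ⋆ λ_{g+ν}`, and `[W̃_n] = ∧^{g-n}[Θ]/(g-n)!`), obtained here
without Riemann's bilinear relations. [cite: LangeBirkenhake1992, §4.2.1 (proof of Poincaré's Formula) and Lemma 4.4.1 (proof)]
[cite: HatcherAT2002, §3.3 Prop. 3.38] [cite: VoisinHodgeI2002, Thm. 6.18, §7.1.1 and Thm. 11.38] -/
theorem exists_thetaClass (h1 : isIso_bettiCohomology_map_abelJacobi) (hC : IsSmoothProjective 1 C)
    (𝒥 : Jacobian C) (P : AlgPoints C ℂ) [Nontrivial (complexBetti C 1)] :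
    ∃ (θ₀ : complexBetti 𝒥.J.X (2 * 1)) (w₀ : complexBetti C (2 * 1)),
      w₀ ≠ 0 ∧ IsRationalClass w₀ ∧ IsRationalClass θ₀ ∧
      IsOfHodgeType 𝒥.J.dim 𝒥.J.X (2 * 1) 1 1 θ₀ ∧
      complexBetti.map (𝒥.abelJacobi P) (2 * 1) θ₀ = w₀ := by
  classical
  obtain ⟨s₁, hs₁, -, hs₁r, hs₁t⟩ := exists_section_degree_one h1 hC 𝒥 P
  have hJ : IsSmoothProjective 𝒥.J.dim 𝒥.J.X := AbelianVariety.isSmoothProjective_holds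
  have h12 : 1 + 1 = 2 * 1 := rfl
  letI := hC.chartedSpace
  haveI := ComplexPoints.compactSpace_of_isSmoothProjective hC
  haveI := ComplexPoints.t2Space_of_isSmoothProjective hC
  haveI hfinq : ∀ k, Module.Finite ℚ (singularCohomology ℚ ℚ (ComplexPoints C) k) := fun k ↦
    finite_singularCohomology_rat_complexPoints hC k
  haveI hfinc : ∀ k, Module.Finite ℂ (complexBetti C k) := fun k ↦ finite_complexBetti hC k
  -- ### (1) Over `ℚ`: the perfect cup pairing on `H¹(C(ℂ); ℚ)` and its dual families
  obtain ⟨ν⟩ := Motives.ComplexPoints.isOrientableOver ℚ hC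
  have hB : (cupPairing ν h12).IsPerfPair := isPerfPair_cupPairing_of_field_holds
  let BE := LinearEquiv.ofBijective (cupPairing ν h12) hB.bijective_left
  let eq := Module.finBasis ℚ (singularCohomology ℚ ℚ (ComplexPoints C) 1)
  let dq : Fin (Module.finrank ℚ (singularCohomology ℚ ℚ (ComplexPoints C) 1)) →
      singularCohomology ℚ ℚ (ComplexPoints C) 1 := fun i ↦ BE.symm (eq.coord i)
  have hdq : ∀ i j, cupPairing ν h12 (dq i) (eq j) = if i = j then 1 else 0 := fun i j ↦ by
    have hi : cupPairing ν h12 (dq i) = eq.coord i := BE.apply_symm_apply (eq.coord i)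
    rw [hi, Module.Basis.coord_apply, Module.Basis.repr_self, Finsupp.single_apply]
    exact if_congr eq_comm rfl rfl
  -- the Kronecker functional; `H²(C(ℂ); ℚ)` is a line
  let kr : singularCohomology ℚ ℚ (ComplexPoints C) (2 * 1) →ₗ[ℚ] ℚ :=
    (kroneckerPairing ℚ ℚ (ComplexPoints C) (2 * 1)).flip ν.fundamentalClass
  have hkr : ∀ x y, kr (cupProduct h12 x y) = cupPairing ν h12 x y := fun x y ↦ by
    rw [LinearMap.flip_apply, cupPairing_apply]
  have hVq : 0 < Module.finrank ℚ (singularCohomology ℚ ℚ (ComplexPoints C) 1) := by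
    have h := finrank_complexBetti_eq_finrank_bettiCohomology C 1
    change Module.finrank ℂ (complexBetti C 1) = Module.finrank ℚ (singularCohomology ℚ ℚ (ComplexPoints C) 1) at h
    rw [← h]
    exact Module.finrank_pos
  let i₀ : Fin (Module.finrank ℚ (singularCohomology ℚ ℚ (ComplexPoints C) 1)) := ⟨0, hVq⟩
  let uq : singularCohomology ℚ ℚ (ComplexPoints C) (2 * 1) := cupProduct h12 (dq i₀) (eq i₀)
  have hkru : kr uq = 1 := by
    change kr (cupProduct h12 (dq i₀) (eq i₀)) = 1
    rw [hkr, hdq, if_pos rfl]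
  have huq : uq ≠ 0 := fun h ↦ by
    rw [h, map_zero] at hkru
    exact zero_ne_one hkru
  have hLq1 : Module.finrank ℚ (singularCohomology ℚ ℚ (ComplexPoints C) (2 * 1)) = 1 := by
    have h := finrank_complexBetti_eq_finrank_bettiCohomology C (2 * 1)
    change Module.finrank ℂ (complexBetti C (2 * 1)) =
      Module.finrank ℚ (singularCohomology ℚ ℚ (ComplexPoints C) (2 * 1)) at h
    rw [← h]
    exact finrank_complexBetti_two_mul_eq_one hC
  have hline : ∀ x : singularCohomology ℚ ℚ (ComplexPoints C) (2 * 1), x = kr x • uq := fun x ↦ by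
    obtain ⟨c, hc⟩ := (finrank_eq_one_iff_of_nonzero' uq huq).1 hLq1 x
    rw [← hc, map_smul, hkru, smul_eq_mul, mul_one c]
  have hcupq : ∀ i j, cupProduct h12 (dq i) (eq j) = (if i = j then (1 : ℚ) else 0) • uq := fun i j ↦ by
    rw [hline (cupProduct h12 (dq i) (eq j)), hkr, hdq]
  -- ### (2) Over `ℂ`: the basis `eᵢ = ι(eᵢ^ℚ)`, the dual family `dᵢ = ι(dᵢ^ℚ)`, `w₀ = ι(u)`
  let w₀ : complexBetti C (2 * 1) := singularCohomology.ringChange (algebraMap ℚ ℂ) _ (2 * 1) uq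
  have hw₀ : w₀ ≠ 0 := fun h ↦ huq ((ringChange_rat_eq_zero_iff uq).1 h)
  let dC : Fin (Module.finrank ℚ (singularCohomology ℚ ℚ (ComplexPoints C) 1)) → complexBetti C 1 :=
    fun i ↦ singularCohomology.ringChange (algebraMap ℚ ℂ) _ 1 (dq i)
  have hli : LinearIndependent ℂ (fun i ↦ singularCohomology.ringChange (algebraMap ℚ ℂ)
      (ComplexPoints C) 1 (eq i)) :=
    (linearIndependent_ringChange_iff _).2 eq.linearIndependent
  have hcard : Fintype.card (Fin (Module.finrank ℚ (singularCohomology ℚ ℚ (ComplexPoints C) 1))) =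
      Module.finrank ℂ (complexBetti C 1) := by
    rw [Fintype.card_fin]
    exact (finrank_complexBetti_eq_finrank_bettiCohomology C 1).symm
  haveI : Nonempty (Fin (Module.finrank ℚ (singularCohomology ℚ ℚ (ComplexPoints C) 1))) := ⟨i₀⟩
  let e : Module.Basis (Fin (Module.finrank ℚ (singularCohomology ℚ ℚ (ComplexPoints C) 1))) ℂ
      (complexBetti C 1) := basisOfLinearIndependentOfCardEqFinrank hli hcard
  have he : ∀ i, e i = singularCohomology.ringChange (algebraMap ℚ ℂ) _ 1 (eq i) := fun i ↦
    congrFun (coe_basisOfLinearIndependentOfCardEqFinrank hli hcard) i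
  have hcupC : ∀ i j, cupProduct h12 (dC i) (e j) = (if i = j then (1 : ℂ) else 0) • w₀ := fun i j ↦ by
    rw [he]
    change cupProduct h12 (singularCohomology.ringChange (algebraMap ℚ ℂ) _ 1 (dq i))
      (singularCohomology.ringChange (algebraMap ℚ ℂ) _ 1 (eq j)) = _
    rw [← singularCohomology.ringChange_cupProduct (algebraMap ℚ ℂ) h12, hcupq, ringChange_ratCast_smul]
    split_ifs <;> simp [w₀]
  -- ### (3) The class `θ' = Σᵢ s₁(dᵢ) ∪ s₁(eᵢ)`
  let θ' : complexBetti 𝒥.J.X (2 * 1) := ∑ i, cupProduct h12 (s₁ (dC i)) (s₁ (e i))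
  have hαθ' : complexBetti.map (𝒥.abelJacobi P) (2 * 1) θ' =
      (Fintype.card (Fin (Module.finrank ℚ (singularCohomology ℚ ℚ (ComplexPoints C) 1))) : ℂ) • w₀ := by
    change complexBetti.map (𝒥.abelJacobi P) (2 * 1) (∑ i, cupProduct h12 (s₁ (dC i)) (s₁ (e i))) = _
    rw [map_sum]
    have hterm : ∀ i, complexBetti.map (𝒥.abelJacobi P) (2 * 1) (cupProduct h12 (s₁ (dC i)) (s₁ (e i))) = w₀ := fun i ↦ by
      rw [complexBetti.map_cupProduct, hs₁, hs₁, hcupC, if_pos rfl, one_smul]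
    simp only [hterm, Finset.sum_const, Finset.card_univ]
    rw [← Nat.cast_smul_eq_nsmul ℂ]
  have hθ'r : IsRationalClass θ' := by
    refine isRationalClass_sum _ _ fun i _ ↦ ?_
    refine (hs₁r _ (isRationalClass_ringChange (dq i))).cup h12 (hs₁r _ ?_)
    rw [he]
    exact isRationalClass_ringChange (eq i)
  -- ### (4) `θ'` is of type `(1, 1)`: the Casimir element in a basis adapted to `H^{1,0} ⊕ H^{0,1}`
  have hdR : ∀ (E : Type) [NormedAddCommGroup E] [NormedSpace ℂ E] [FiniteDimensional ℂ E],
      Literature.NumberTheory.Transcendental.exists_deRhamIsoFamily (modelWithCornersSelf ℝ E) :=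
    fun E _ _ _ ↦ Literature.NumberTheory.Transcendental.exists_deRhamIsoFamily_holds E
  have hcupJ : CupPreservesHodgeType 𝒥.J.dim 𝒥.J.X := cupPreservesHodgeType_of_multiplicative_deRham hdR hJ
  have hcupCC : CupPreservesHodgeType 1 C := cupPreservesHodgeType_of_multiplicative_deRham hdR hC
  obtain ⟨A⟩ := nonempty_hodgeModel_holds (n := 1) (X := C) hC
  obtain ⟨MJ⟩ := nonempty_hodgeModel_holds (n := 𝒥.J.dim) (X := 𝒥.J.X) hJ
  -- the cup product `H¹ × H¹ → H²` is perfect over `ℂ`: `Q♭ : H¹ ≅ Hom(H¹, H²)`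
  let μ : OrientationFamily := fun _ _ h ↦ Classical.choice (Motives.ComplexPoints.isOrientableOver ℂ h)
  have hQinj : ∀ x : complexBetti C 1, (∀ y, cupProduct h12 x y = 0) → x = 0 := fun x hx ↦
    eq_zero_of_forall_cupPairing_eq_zero μ hC h12 fun y ↦ by
      rw [cupPairing_apply, hx y, map_zero, LinearMap.zero_apply]
  have hQinj' : Function.Injective
      (cupProduct h12 : complexBetti C 1 →ₗ[ℂ] complexBetti C 1 →ₗ[ℂ] complexBetti C (2 * 1)) :=
    (injective_iff_map_eq_zero _).2 fun x hx ↦ hQinj x fun y ↦ by rw [hx, LinearMap.zero_apply]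
  have hdimHom : Module.finrank ℂ (complexBetti C 1 →ₗ[ℂ] complexBetti C (2 * 1)) =
      Module.finrank ℂ (complexBetti C 1) := by
    rw [Module.finrank_linearMap, finrank_complexBetti_two_mul_eq_one hC, mul_one]
  have hQbij : Function.Bijective
      (cupProduct h12 : complexBetti C 1 →ₗ[ℂ] complexBetti C 1 →ₗ[ℂ] complexBetti C (2 * 1)) :=
    ⟨hQinj', (LinearMap.injective_iff_surjective_of_finrank_eq_finrank hdimHom.symm).1 hQinj'⟩
  let QE := LinearEquiv.ofBijective _ hQbij
  have hdC : ∀ i, dC i = QE.symm ((e.coord i).smulRight w₀) := fun i ↦ by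
    apply QE.injective
    rw [LinearEquiv.apply_symm_apply]
    refine e.ext fun j ↦ ?_
    change cupProduct h12 (dC i) (e j) = (e.coord i) (e j) • w₀
    rw [hcupC, Module.Basis.coord_apply, Module.Basis.repr_self, Finsupp.single_apply]
    exact congrArg (· • w₀) (if_congr eq_comm rfl rfl)
  -- the adapted basis `e'` and its dual family `d'`
  let e' := (A.isInternal_typePiece 1).collectedBasis fun t ↦ Module.finBasis ℂ (A.typePiece 1 t)
  let d' : (Σ t : ↥(Finset.HasAntidiagonal.antidiagonal 1), Fin (Module.finrank ℂ (A.typePiece 1 t))) →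
      complexBetti C 1 := fun i ↦ QE.symm ((e'.coord i).smulRight w₀)
  let Θ : complexBetti C 1 →ₗ[ℂ] complexBetti C 1 →ₗ[ℂ] complexBetti 𝒥.J.X (2 * 1) :=
    (cupProduct h12).compl₁₂ s₁ s₁
  have hθ'eq : θ' = ∑ i, Θ (d' i) (e' i) := by
    change ∑ i, cupProduct h12 (s₁ (dC i)) (s₁ (e i)) = _
    have hcas := sum_casimir_eq QE w₀ Θ e e'
    simp only [Θ, LinearMap.compl₁₂_apply] at hcas ⊢
    rw [← hcas]
    exact Finset.sum_congr rfl fun i _ ↦ by rw [hdC]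
  have he't : ∀ i, e' i ∈ A.typePiece 1 i.1 := fun i ↦ (A.isInternal_typePiece 1).collectedBasis_mem _ i
  have hd'Q : ∀ i j, cupProduct h12 (d' i) (e' j) = (if i = j then (1 : ℂ) else 0) • w₀ := fun i j ↦ by
    have hi : cupProduct h12 (d' i) = (e'.coord i).smulRight w₀ := QE.apply_symm_apply _
    rw [hi, LinearMap.smulRight_apply, Module.Basis.coord_apply, Module.Basis.repr_self, Finsupp.single_apply]
    exact congrArg (· • w₀) (if_congr eq_comm rfl rfl)
  -- combinatorics of the antidiagonal of `1`: `{(1,0), (0,1)}`, exchanged by the swap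
  let swap : ↥(Finset.HasAntidiagonal.antidiagonal 1) → ↥(Finset.HasAntidiagonal.antidiagonal 1) :=
    fun t ↦ ⟨t.1.swap, Finset.HasAntidiagonal.mem_antidiagonal.2 (by
      have h := Finset.HasAntidiagonal.mem_antidiagonal.1 t.2
      rw [Prod.fst_swap, Prod.snd_swap, add_comm]
      exact h)⟩
  have hanti : ∀ t t' : ↥(Finset.HasAntidiagonal.antidiagonal 1), t' ≠ t → t' = swap t := by
    rintro ⟨⟨a, b⟩, hab⟩ ⟨⟨a', b'⟩, hab'⟩ hne
    have h1 := Finset.HasAntidiagonal.mem_antidiagonal.1 hab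
    have h2 := Finset.HasAntidiagonal.mem_antidiagonal.1 hab'
    change a + b = 1 at h1
    change a' + b' = 1 at h2
    have hne' : ¬ (a' = a ∧ b' = b) := fun h ↦ hne (Subtype.ext (Prod.ext h.1 h.2))
    refine Subtype.ext (Prod.ext ?_ ?_)
    · change a' = b
      omega
    · change b' = a
      omega
  have hswap_ne : ∀ t : ↥(Finset.HasAntidiagonal.antidiagonal 1), swap t ≠ t := by
    rintro ⟨⟨a, b⟩, hab⟩ heq
    have h1 := Finset.HasAntidiagonal.mem_antidiagonal.1 hab
    change a + b = 1 at h1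
    have h2 := congrArg (fun t : ↥(Finset.HasAntidiagonal.antidiagonal 1) ↦ t.1.1) heq
    change b = a at h2
    omega
  -- `H^{t} ∪ H^{t} = 0` on the curve for `t = (1,0), (0,1)`
  have hQtype : ∀ (t : ↥(Finset.HasAntidiagonal.antidiagonal 1)) (x y : complexBetti C 1),
      x ∈ A.typePiece 1 t → y ∈ A.typePiece 1 t → cupProduct h12 x y = 0 := by
    intro t x y hx hy
    have hxy : IsOfHodgeType 1 C (2 * 1) (t.1.1 + t.1.1) (t.1.2 + t.1.2) (cupProduct h12 x y) :=
      hcupCC h12 ((A.mem_typePiece_iff_isOfHodgeType hC t x).1 hx)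
        ((A.mem_typePiece_iff_isOfHodgeType hC t y).1 hy)
    have ht := Finset.HasAntidiagonal.mem_antidiagonal.1 t.2
    let tt : ↥(Finset.HasAntidiagonal.antidiagonal (2 * 1)) :=
      ⟨(t.1.1 + t.1.1, t.1.2 + t.1.2), Finset.HasAntidiagonal.mem_antidiagonal.2 (by
        change t.1.1 + t.1.1 + (t.1.2 + t.1.2) = 2 * 1
        omega)⟩
    have hmem := (A.mem_typePiece_iff_isOfHodgeType hC tt _).2 hxy
    have hbot : A.typePiece (2 * 1) tt = ⊥ := by
      rcases Nat.eq_zero_or_pos t.1.1 with h | h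
      · exact A.typePiece_eq_bot_of_lt_snd tt (by change 1 < t.1.2 + t.1.2; omega)
      · exact A.typePiece_eq_bot_of_lt_fst tt (by change 1 < t.1.1 + t.1.1; omega)
    rw [hbot, Submodule.mem_bot] at hmem
    exact hmem
  -- the dual vector of a basis vector of type `t` is of type `swap t`
  have hd't : ∀ i, d' i ∈ A.typePiece 1 (swap i.1) := by
    intro i
    have hxmem : A.typeProj 1 i.1 (d' i) ∈ A.typePiece 1 i.1 := A.typeProj_mem 1 i.1 (d' i)
    have hdec : d' i = A.typeProj 1 i.1 (d' i) + A.typeProj 1 (swap i.1) (d' i) := by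
      have hs := A.sum_typeProj 1 (d' i)
      rw [← Finset.sum_erase_add _ _ (Finset.mem_univ i.1)] at hs
      have hrest : (Finset.univ.erase i.1 : Finset ↥(Finset.HasAntidiagonal.antidiagonal 1)) = {swap i.1} := by
        ext t
        simp only [Finset.mem_erase, Finset.mem_univ, and_true, Finset.mem_singleton]
        exact ⟨fun h ↦ hanti _ _ h, fun h ↦ h ▸ hswap_ne i.1⟩
      rw [hrest, Finset.sum_singleton, add_comm] at hs
      exact hs.symm
    have hx0 : A.typeProj 1 i.1 (d' i) = 0 := by
      refine hQinj _ fun y ↦ ?_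
      suffices h : cupProduct h12 (A.typeProj 1 i.1 (d' i)) = 0 by rw [h, LinearMap.zero_apply]
      refine e'.ext fun j ↦ ?_
      rw [LinearMap.zero_apply]
      by_cases hj : j.1 = i.1
      · exact hQtype i.1 _ (e' j) hxmem (by rw [← hj]; exact he't j)
      · have hij : i ≠ j := fun h ↦ hj (h ▸ rfl)
        have h0 : cupProduct h12 (d' i) (e' j) = 0 := by rw [hd'Q, if_neg hij, zero_smul]
        have hj' : j.1 = swap i.1 := hanti _ _ hj
        have h2 : cupProduct h12 (A.typeProj 1 (swap i.1) (d' i)) (e' j) = 0 :=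
          hQtype (swap i.1) _ _ (A.typeProj_mem _ _ _) (by rw [← hj']; exact he't j)
        have h3 := congrArg (fun v ↦ cupProduct h12 v (e' j)) hdec
        simp only [map_add, LinearMap.add_apply, h0, h2, add_zero] at h3
        exact h3.symm
    rw [hdec, hx0, zero_add]
    exact A.typeProj_mem _ _ _
  have hθ't : IsOfHodgeType 𝒥.J.dim 𝒥.J.X (2 * 1) 1 1 θ' := by
    rw [hθ'eq]
    refine IsOfHodgeType.sum hJ MJ _ _ fun i _ ↦ ?_
    change IsOfHodgeType 𝒥.J.dim 𝒥.J.X (2 * 1) 1 1 (cupProduct h12 (s₁ (d' i)) (s₁ (e' i)))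
    have ht := Finset.HasAntidiagonal.mem_antidiagonal.1 i.1.2
    have hd := hs₁t (i.1.1.2) (i.1.1.1) (d' i) (by rw [add_comm]; exact ht)
      ((A.mem_typePiece_iff_isOfHodgeType hC (swap i.1) _).1 (hd't i))
    have he' := hs₁t (i.1.1.1) (i.1.1.2) (e' i) ht ((A.mem_typePiece_iff_isOfHodgeType hC i.1 _).1 (he't i))
    have h := hcupJ h12 hd he'
    have hs1 : i.1.1.2 + i.1.1.1 = 1 := by rw [add_comm]; exact ht
    have hs2 : i.1.1.1 + i.1.1.2 = 1 := ht
    rw [hs1, hs2] at h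
    exact h
  -- ### (5) normalise: `θ₀ = (card)⁻¹ θ'`
  set N := Fintype.card (Fin (Module.finrank ℚ (singularCohomology ℚ ℚ (ComplexPoints C) 1))) with hN
  have hN0 : (N : ℂ) ≠ 0 := by
    rw [hN, Fintype.card_fin, Nat.cast_ne_zero]
    exact hVq.ne'
  refine ⟨(((N : ℚ)⁻¹ : ℚ) : ℂ) • θ', w₀, hw₀, isRationalClass_ringChange uq, hθ'r.smul _, hθ't.smul _, ?_⟩
  rw [map_smul, hαθ', smul_smul]
  have hc : (((N : ℚ)⁻¹ : ℚ) : ℂ) * (N : ℂ) = 1 := by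
    push_cast
    exact inv_mul_cancel₀ hN0
  rw [hc, one_smul]

/-- **Degree `2`: `s₂(c · w₀) = c · θ₀`.** `H²(C(ℂ); ℂ)` is the line through the rational class
`w₀` (`finrank_complexBetti_two_mul_eq_one`); with `θ₀` of `exists_thetaClass`, `s₂` is a section
of `(f^P)^*`, maps rational classes to rational classes (the coordinate of a rational class along
`w₀` is rational) and classes of type `(1, 1)` to classes of type `(1, 1)` (the only type present in
`H²` of a curve). [cite: Lange2023AbelianVarietiesC, Lemma 4.4.1 (proof)] [cite: VoisinHodgeI2002, §7.1.1] -/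
theorem exists_section_degree_two (h1 : isIso_bettiCohomology_map_abelJacobi)
    (hC : IsSmoothProjective 1 C) (𝒥 : Jacobian C) (P : AlgPoints C ℂ) [Nontrivial (complexBetti C 1)] :
    ∃ s₂ : complexBetti C (2 * 1) →ₗ[ℂ] complexBetti 𝒥.J.X (2 * 1),
      (∀ y, complexBetti.map (𝒥.abelJacobi P) (2 * 1) (s₂ y) = y) ∧
      (∀ y, IsRationalClass y → IsRationalClass (s₂ y)) ∧
      (∀ p q (y : complexBetti C (2 * 1)), p + q = 2 * 1 → IsOfHodgeType 1 C (2 * 1) p q y →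
        IsOfHodgeType 𝒥.J.dim 𝒥.J.X (2 * 1) p q (s₂ y)) := by
  classical
  obtain ⟨θ₀, w₀, hw₀, hw₀r, hθr, hθt, hαθ⟩ := exists_thetaClass h1 hC 𝒥 P
  have hJ : IsSmoothProjective 𝒥.J.dim 𝒥.J.X := AbelianVariety.isSmoothProjective_holds
  have hL1 : Module.finrank ℂ (complexBetti C (2 * 1)) = 1 := finrank_complexBetti_two_mul_eq_one hC
  haveI : FiniteDimensional ℂ (complexBetti C (2 * 1)) := Module.finite_of_finrank_eq_succ hL1
  let bL := FiniteDimensional.basisSingleton Unit hL1 w₀ hw₀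
  have hcoord : ∀ y : complexBetti C (2 * 1), bL.coord default y • w₀ = y := fun y ↦ by
    have h := bL.sum_repr y
    rw [Fintype.sum_unique, FiniteDimensional.basisSingleton_apply] at h
    exact h
  refine ⟨(bL.coord default).smulRight θ₀, fun y ↦ ?_, fun y hy ↦ ?_, fun p q y hpq hy ↦ ?_⟩
  · rw [LinearMap.smulRight_apply, map_smul, hαθ, hcoord]
  · rw [LinearMap.smulRight_apply]
    have hz : IsRationalClass (∑ i : Unit, (fun _ ↦ bL.coord default y) i • (fun _ : Unit ↦ w₀) i) := by
      rw [Fintype.sum_unique]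
      change IsRationalClass (bL.coord default y • w₀)
      rw [hcoord]
      exact hy
    obtain ⟨r, hr⟩ := IsRationalClass.coeff_mem_range_of_linearIndependent (fun _ ↦ hw₀r)
      (linearIndependent_unique_iff.2 hw₀) hz ()
    change algebraMap ℚ ℂ r = bL.coord default y at hr
    rw [← hr, eq_ratCast]
    exact hθr.smul r
  · rw [LinearMap.smulRight_apply]
    by_cases h11 : p = 1 ∧ q = 1
    · obtain ⟨rfl, rfl⟩ := h11
      exact hθt.smul _
    · obtain ⟨A⟩ := nonempty_hodgeModel_holds (n := 1) (X := C) hC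
      obtain ⟨MJ⟩ := nonempty_hodgeModel_holds (n := 𝒥.J.dim) (X := 𝒥.J.X) hJ
      let t : ↥(Finset.HasAntidiagonal.antidiagonal (2 * 1)) :=
        ⟨(p, q), Finset.HasAntidiagonal.mem_antidiagonal.2 hpq⟩
      have hbot : A.typePiece (2 * 1) t = ⊥ := by
        rcases Nat.lt_or_ge 1 p with h | h
        · exact A.typePiece_eq_bot_of_lt_fst t h
        · exact A.typePiece_eq_bot_of_lt_snd t (by change 1 < q; omega)
      have hy0 : y = 0 := by
        have hmem := (A.mem_typePiece_iff_isOfHodgeType hC t y).2 hy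
        rw [hbot, Submodule.mem_bot] at hmem
        exact hmem
      rw [hy0, map_zero, zero_smul]
      exact IsOfHodgeType.zero MJ _ p q

/-- **A rational, type-preserving section of `(f^P)^* : H*(J(ℂ); ℂ) → H*(C(ℂ); ℂ)` in every
degree**, for a smooth projective curve `C` of genus `g ≥ 1` with a point `P`, granted the `H¹`
fact: degrees `0` (units), `1` (the inverse of `(f^P)^*`), `2` (the theta class) and `≥ 3` (zero).
[cite: Lange2023AbelianVarietiesC, §4.1.1 and Lemma 4.4.1 (proof)] -/
theorem exists_section_abelJacobi (h1 : isIso_bettiCohomology_map_abelJacobi)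
    (hC : IsSmoothProjective 1 C) (𝒥 : Jacobian C) (P : AlgPoints C ℂ) [Nontrivial (complexBetti C 1)] :
    ∃ s : ∀ k, complexBetti C k →ₗ[ℂ] complexBetti 𝒥.J.X k,
      (∀ k y, complexBetti.map (𝒥.abelJacobi P) k (s k y) = y) ∧
      (∀ k y, IsRationalClass y → IsRationalClass (s k y)) ∧
      (∀ k p q (y : complexBetti C k), p + q = k → IsOfHodgeType 1 C k p q y →
        IsOfHodgeType 𝒥.J.dim 𝒥.J.X k p q (s k y)) := by
  have hJ : IsSmoothProjective 𝒥.J.dim 𝒥.J.X := AbelianVariety.isSmoothProjective_holds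
  have hk : ∀ k, ∃ s : complexBetti C k →ₗ[ℂ] complexBetti 𝒥.J.X k,
      (∀ y, complexBetti.map (𝒥.abelJacobi P) k (s y) = y) ∧
      (∀ y, IsRationalClass y → IsRationalClass (s y)) ∧
      (∀ p q (y : complexBetti C k), p + q = k → IsOfHodgeType 1 C k p q y →
        IsOfHodgeType 𝒥.J.dim 𝒥.J.X k p q (s y)) := by
    intro k
    match k with
    | 0 => exact exists_section_degree_zero hC hJ (𝒥.abelJacobi P)
    | 1 =>
      obtain ⟨s₁, h₁, -, h₂, h₃⟩ := exists_section_degree_one h1 hC 𝒥 P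
      exact ⟨s₁, h₁, h₂, h₃⟩
    | 2 => exact exists_section_degree_two h1 hC 𝒥 P
    | k + 3 => exact exists_section_degree_ge_three hC 𝒥 (𝒥.abelJacobi P) (by omega)
  choose s hs₁ hs₂ hs₃ using hk
  exact ⟨s, hs₁, hs₂, hs₃⟩

end Curve

/-! ### 7. The powers: induction over `N`, and the fact without a polarization -/

section Powers

variable {C : SchemeOver ℂ}

/-- **A rational, type-preserving section of `(αᴺ⁺¹)^* : H*(Jᴺ⁺¹(ℂ); ℂ) → H*(Cᴺ⁺¹(ℂ); ℂ)`** for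
`g ≥ 1`, granted the `H¹` fact: the morphism `αᴺ⁺¹ = αᴺ × α : Cᴺ⁺¹ → Jᴺ⁺¹` (`α = f^P`,
`C¹ = Spec ℂ ⊗ C ≅ C`) together with linear maps `S_k : Hᵏ(Cᴺ⁺¹(ℂ); ℂ) → Hᵏ(Jᴺ⁺¹(ℂ); ℂ)` with
`(αᴺ⁺¹)^* ∘ S_k = 𝟙`, mapping rational classes to rational classes and classes of type `(p, q)`
to classes of type `(p, q)` — by induction, the Künneth step (`exists_kunnethSection` and its
three properties, with rational Künneth bases `exists_basis_isRationalClass`) applied to the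
section of `α^*` (`exists_section_abelJacobi`). [cite: Lange2023AbelianVarietiesC, §4.1.1 and Lemma 4.4.1 (proof)]
[cite: HatcherAT2002, §3.2 Thm. 3.16] [cite: VoisinHodgeI2002, Thm. 11.38] -/
theorem exists_section_pow (h1 : isIso_bettiCohomology_map_abelJacobi) (hC : IsSmoothProjective 1 C)
    (𝒥 : Jacobian C) (P : AlgPoints C ℂ) [Nontrivial (complexBetti C 1)] :
    ∀ N : ℕ, ∃ (g : C.pow (N + 1) ⟶ (𝒥.J.powSucc N).X)
      (S : ∀ k, complexBetti (C.pow (N + 1)) k →ₗ[ℂ] complexBetti (𝒥.J.powSucc N).X k),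
      (∀ k z, complexBetti.map g k (S k z) = z) ∧
      (∀ k z, IsRationalClass z → IsRationalClass (S k z)) ∧
      (∀ k p q (z : complexBetti (C.pow (N + 1)) k), p + q = k →
        IsOfHodgeType (N + 1) (C.pow (N + 1)) k p q z →
        IsOfHodgeType (𝒥.J.powSucc N).dim (𝒥.J.powSucc N).X k p q (S k z))
  | 0 => by
    obtain ⟨s, hs₁, hs₂, hs₃⟩ := exists_section_abelJacobi h1 hC 𝒥 P
    have hJ : IsSmoothProjective 𝒥.J.dim 𝒥.J.X := AbelianVariety.isSmoothProjective_holds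
    have hC1 : IsSmoothProjective (0 + 1) (C.pow (0 + 1)) := isSmoothProjective_pow_succ_of_curve hC 0
    refine ⟨(λ_ C).hom ≫ 𝒥.abelJacobi P, fun k ↦ s k ∘ₗ (complexBetti.map (λ_ C).inv k).hom,
      fun k z ↦ ?_, fun k z hz ↦ ?_, fun k p q z hpq hz ↦ ?_⟩
    · have e1 : complexBetti.map ((λ_ C).hom ≫ 𝒥.abelJacobi P) k (s k (complexBetti.map (λ_ C).inv k z)) =
          complexBetti.map (λ_ C).hom k
            (complexBetti.map (𝒥.abelJacobi P) k (s k (complexBetti.map (λ_ C).inv k z))) :=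
        complexBetti.map_comp_apply' _ _ _ _
      have e2 : complexBetti.map (𝒥.abelJacobi P) k (s k (complexBetti.map (λ_ C).inv k z)) =
          complexBetti.map (λ_ C).inv k z := hs₁ k _
      have e3 : complexBetti.map (λ_ C).hom k (complexBetti.map (λ_ C).inv k z) = z := by
        have h := complexBetti.map_comp_apply' (λ_ C).hom (λ_ C).inv k z
        rw [Iso.hom_inv_id, complexBetti.map_id] at h
        exact h.symm
      exact e1.trans ((congrArg (complexBetti.map (λ_ C).hom k) e2).trans e3)
    · exact hs₂ k _ (hz.map _)
    · exact hs₃ k p q _ hpq (hz.map_of_isSmoothProjective hC hC1 (λ_ C).inv)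
  | N + 1 => by
    classical
    obtain ⟨g, S, hS₁, hS₂, hS₃⟩ := exists_section_pow h1 hC 𝒥 P N
    obtain ⟨s, hs₁, hs₂, hs₃⟩ := exists_section_abelJacobi h1 hC 𝒥 P
    have hJ : IsSmoothProjective 𝒥.J.dim 𝒥.J.X := AbelianVariety.isSmoothProjective_holds
    have hCN : IsSmoothProjective (N + 1) (C.pow (N + 1)) := isSmoothProjective_pow_succ_of_curve hC N
    have hJN : IsSmoothProjective (𝒥.J.powSucc N).dim (𝒥.J.powSucc N).X :=
      AbelianVariety.isSmoothProjective_holds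
    -- rational Künneth bases of the `Hʲ(C(ℂ); ℂ)`, `j ≤ 2`
    choose r b hb using fun j : Fin (2 * 1 + 1) ↦ exists_basis_isRationalClass hC (j : ℕ)
    choose S' hS' using fun k ↦ exists_kunnethSection hCN hC b S s k
    have hdim : (𝒥.J.powSucc (N + 1)).dim = (𝒥.J.powSucc N).dim + 𝒥.J.dim := by
      rw [AbelianVariety.powSucc_succ, AbelianVariety.dim_prod]
    refine ⟨g ⊗ₘ 𝒥.abelJacobi P, S', fun k z ↦ ?_, fun k z hz ↦ ?_, fun k p q z hpq hz ↦ ?_⟩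
    · exact kunnethSection_map hCN hC b g (𝒥.abelJacobi P) S s hS₁ hs₁ k (S' k) (hS' k) z
    · exact kunnethSection_isRationalClass hCN hC b hb S s hS₂ hs₂ k (S' k) (hS' k) hz
    · rw [hdim]
      exact kunnethSection_isOfHodgeType hCN hC hJN hJ b S s hS₃ hs₃ k (S' k) (hS' k) hpq hz

/-- **`CurvePowerHodgeClassesLiftToJacobianPowers` from the `H¹` fact ALONE (no polarization).**
For `C` smooth projective of dimension `1` over `ℂ`, `𝒥` a Jacobian and `N, p`: if
`H¹(C(ℂ); ℂ) = 0` every class of `H²ᵖ(Cᴺ⁺¹(ℂ); ℂ)` is algebraic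
(`curvePowerHodgeClassesLift_of_subsingleton`); otherwise `G = (αᴺ⁺¹)^*`, which carries algebraic
classes to algebraic classes (`forall_map_mem_algebraicClasses_of_abelianVariety`, Fulton
Cor. 19.2 (b) by moving with translations), and a rational class `a` of type `(p, p)` is `G b` for
the rational class `b = S(a)` of type `(p, p)` given by the explicit section of
`exists_section_pow` — Voisin's Cor. 2.12 ("`φ` has a left inverse as morphism of Hodge
structures") with the left inverse written down instead of deduced from a polarization.
[cite: Voisin2025, Cor. 2.12 and Prop. 2.11] [cite: Lange2023AbelianVarietiesC, §4.1.1 and Lemma 4.4.1 (proof)]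
[cite: Fulton1998, §19.2 Cor. 19.2 (b) and Example 19.1.11] -/
theorem CurvePowerHodgeClassesLiftToJacobianPowers_of_isIso (h1 : isIso_bettiCohomology_map_abelJacobi) :
    CurvePowerHodgeClassesLiftToJacobianPowers := by
  intro C hC 𝒥 N p
  rcases subsingleton_or_nontrivial (complexBetti C 1) with hs | hn
  · exact curvePowerHodgeClassesLift_of_subsingleton hC 𝒥 N p
  · obtain ⟨P⟩ := nonempty_algPoints_of_isSmoothProjective hC
    obtain ⟨g, S, hS₁, hS₂, hS₃⟩ := exists_section_pow h1 hC 𝒥 P N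
    refine ⟨(complexBetti.map g (2 * p)).hom,
      forall_map_mem_algebraicClasses_of_abelianVariety (isSmoothProjective_pow_succ_of_curve hC N)
        (𝒥.J.powSucc N) g p, fun a ha haH ↦ ?_⟩
    refine ⟨S (2 * p) a, hS₂ _ _ ha, hS₃ _ p p a (two_mul p).symm haH, ?_⟩
    have h : (complexBetti.map g (2 * p)).hom (S (2 * p) a) = a := hS₁ _ a
    rw [h, sub_self]
    exact Submodule.zero_mem _

/-- **`CurvePowerHodgeClassesLiftToJacobianPowers` from `two_mul_dim_eq_finrank_bettiCohomology`
alone** (`2 dim J = b₁(C(ℂ))`, Milne Prop. 2.1 — the leaf of the decomposition of the `H¹` fact,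
equivalent to it by `Motives.two_mul_dim_eq_finrank_bettiCohomology_iff_isIso`).
[cite: Milne1986JacobianVarieties, §2 Prop. 2.1 and Thm. 2.5] [cite: Voisin2025, Cor. 2.12] -/
theorem CurvePowerHodgeClassesLiftToJacobianPowers_of_two_mul_dim_eq
    (h : two_mul_dim_eq_finrank_bettiCohomology) : CurvePowerHodgeClassesLiftToJacobianPowers :=
  CurvePowerHodgeClassesLiftToJacobianPowers_of_isIso (isIso_bettiCohomology_map_abelJacobi_of_two_mul_dim_eq h)

/-- The same from the residual INEQUALITY `b₁(C(ℂ)) ≤ 2 dim J(C)` for the Jacobians of smooth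
projective complex curves (the other inequality is the tree's theorem
`Jacobian.two_mul_dim_le_finrank_bettiCohomology`). [cite: Lange2023AbelianVarietiesC, §4.1.1 and Lemma 4.4.1 (proof)] -/
theorem CurvePowerHodgeClassesLiftToJacobianPowers_of_finrank_le
    (h : ∀ (C : SchemeOver ℂ), IsSmoothProjective 1 C → ∀ (𝒥 : Jacobian C),
      Module.finrank ℚ (bettiCohomology C 1) ≤ 2 * 𝒥.J.dim) :
    CurvePowerHodgeClassesLiftToJacobianPowers :=
  CurvePowerHodgeClassesLiftToJacobianPowers_of_isIso (isIso_bettiCohomology_map_abelJacobi_of_finrank_le_two_mul_dim h)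

/-- **Hodge classes on powers of a smooth projective complex curve lift to powers of its Jacobian**
(the named fact `CurvePowerHodgeClassesLiftToJacobianPowers` of
`HodgeTheory/FermatHodgeClassesLiftToCurveAndJacobianPowers` holds): by the reduction
`CurvePowerHodgeClassesLiftToJacobianPowers_of_two_mul_dim_eq` above it suffices that
`2 dim J(C) = b₁(C)` for every Jacobian, which is `two_mul_dim_eq_finrank_bettiCohomology_holds`
(`Motives/JacobianDimensionBettiProofs`: Weil's construction of the Jacobian, Milne §7 Thm. 7.1,
with the Hodge decomposition of `H¹`). [cite: Voisin2025, Prop. 2.11 and Cor. 2.12] [cite: Lange2023AbelianVarietiesC, §4.1.1 and Lemma 4.4.1 (proof)] [cite: Milne1986JacobianVarieties, §2 Prop. 2.1 and §7 Thm. 7.1] -/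
theorem CurvePowerHodgeClassesLiftToJacobianPowers_holds : CurvePowerHodgeClassesLiftToJacobianPowers :=
  CurvePowerHodgeClassesLiftToJacobianPowers_of_two_mul_dim_eq two_mul_dim_eq_finrank_bettiCohomology_holds

end Powers

end Literature.AlgebraicGeometry.HodgeTheory

end
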